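import Mathlib
import HarnessLib
import HarnessLib.Audit
import Summits.QuantumFields.Statement
import Literature.MathematicalPhysics.QuantumFieldTheory.YangMillsOS
import Summits.QuantumFields.YangMills.Theorems.PencilRigidityCurvatureChannel
import Summits.QuantumFields.YangMills.Theorems.PencilRigidityPlanarToEuclidean
import Summits.QuantumFields.YangMills.Theorems.HypercubicLimit.Negative.OneFieldReduction
import HarnessLib.Audit.Status.Attr

/-!
Route: MirrorModularBoosts

# Route MirrorModularBoosts — E1 of the Wilson limit from sixteen mirrors — diagonal light cone,
axis-wedge modular boosts, tr F² as the boost-scalar channel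

It suffices to show X := (H) HypercubicLimit ∧ (D) DiagonalMirrorRPR ∧ (C) PlanarSpectralCone ∧ (B)
CurvatureBoostCovariance, realising card mirror-wedges-modular-boosts-v2 ("sixteen mirrors are three
modular boosts"), corrected for SPECIES SCALARITY (see Why this line). (H) [shared verbatim with
route CoincidenceRotationBootstrap, item HypercubicLimit]: for every compact simple G a Wilson
scaling limit S of ALL gauge-invariant lattice observables with every clause of `YangMills` except
the rotation half of E1 (E0, E0', E2, E3, E4, translations, PROPER hypercubic invariance
W(B₄)∩SO(4), IsYangMillsFor-convergence along a sequential scheme, non-triviality and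
non-Gaussianity of the curvature species, continuum and uniform lattice mass gap). (D) the curvature
channel S₁ (renormalised action density, i.e. tr F²) of any such limit — S₁ carrying the whole
curvature-channel package W₁: lattice convergence on ⁰𝒮, E0/E0'/E2(e₀)/E3/E4, translations, proper
hypercubic invariance, continuum gap and uniform lattice gap — is reflection positive across the
DIAGONAL mirrors x₀ = ±x₁ (Wilson's plaquette action is RP there on free boxes; the torus limit must
inherit it). [REPAIRED 2026-08-15 as item DiagonalMirrorRPR: the first filing DiagonalMirrorRP
constrained S₁ only for n ≠ 0 and assumed no E0, so S₁ 0 := −δ over the zero scheme made the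
degree-0 E2 term −1 (Theorems.MirrorModularBoostsDiagonalMirrorRP_refuted); E0 inside W₁ pins S₁ 0
and the conclusion reads S₁ only at n = 0 and on ⁰𝒮; the refuted statement is settled negative
knowledge, its negation kept compiled as support NotDiagonalMirrorRP.] (C) [model-blind] a
translation-invariant, symmetric (E3), tempered (E0') one-species Schwinger family on ℝ⁴ that is
reflection positive (tree E2 of the pulled-back family) in the eight frames whose time axis is a
unit normal ±e₀, ±e₁, (±e₀±e₁)/√2 of the four mirror LINES of the (x₀,x₁)-plane has the planar
spectral condition H ≥ |P₁| after OS reconstruction along e₀ — typed as joint holomorphy of (t,b) ↦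
𝔖(ΘF* ⊗ G_(t e₀ + b e₁)) = ⟨Ψ_F, e^(−tH) e^(ibP₁) Ψ_G⟩ on {(ζ,β) : |Im β| < Re ζ} with the
Cauchy–Schwarz bound ‖Ψ_F‖‖Ψ_G‖. (B) [the modular engine, YM-specific] for the curvature channel of
a Wilson limit the eight plane mirrors plus the cone force invariance of ALL its n-point functions
under every rotation of the (x₀,x₁)-plane; intended proof: Ω is standard for the axis-wedge algebra,
Borchers' half-sided theorem turns the cone into boost–translation relations for Δ^(it), geometric
action of the three axis-wedge modular groups closes to a covariant representation of P↑₊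
(Borchers1996, BrunettiGuidoLongo2002, BuchholzEtAl2000), tr F² — the unique reflection-even
gauge-invariant field of dimension 4 — is covariant under it, and Euclidean rotations are the
imaginary-rapidity values of the boosts (OsterwalderSchrader1973 §4.2 run backwards). [JUDGE REPAIR
2026-08-16 — THE TYPED SCALARITY HYPOTHESIS: the model-blind core of (B) is false (the
W(B₄)-symmetric Gaussian Ĉ(p) = (1+ε e₂(p_μ²)²)/(p²+m²) is RP in all 16 mirrors, gapped, coned and
anisotropic), so (B) is now carried by the glued pair (K) CurvatureKernelBound → (B′)
SoftKernelBoostCovariance → (B) (pure-logic glue, recorded as the support KernelBoundEngineGlue),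
and since rev 13 (2026-08-16, crux-only deciding theorem) `closes` consumes exactly the five cruxes
(K), (B′), (C), (D), (H): the glue is inlined, the proved supports CurvatureChannel /
PlanarToEuclidean are used through their landed proofs, and the species bookkeeping of
SpeciesProjectionPlanar is re-derived inside the proof from the tree's one-field reduction
(Theorems.HypercubicLimit.Negative.OneFieldReduction), its own landed proof importing this file. (K)
[shared verbatim with route PencilRigidity, item CurvatureKernelBound]: the two-point function of
the curvature channel on ⁰𝒮 is integration against a REAL kernel K(x₀−x₁), continuous on ℝ⁴∖0, with
|K(x)| ≤ C(1+|x|^(η−10)) for some η > 0 — 'tr F² has dimension < 5' (expected |x|⁻⁸log⁻²; the first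
hypercubic-only admixture Σ_μ tr(D_μF_μν)² has dimension 6 and an anisotropic W(B₄)-scalar component
of any field costs dimension ≥ 5). It PROVABLY EXCLUDES the witness class: the kernel of Ĉ is
(4π²)⁻¹[|x|⁻² + ε h₈(x̂)|x|⁻¹⁰] + O(|x|⁻⁸|log|x||) with h₈ := |x|¹⁸·e₂(∂²)²|x|⁻² a nonzero harmonic
octic (exact rational computation, planner zoo_kernel.py: h₈(e₀) = 235008, h₈((1,1,1,1)/2) = 27648,
h₈((2,1,0,0)/√5) = −2101.2; e₂² ∉ (p²) as e₁,…,e₄ are algebraically independent), violating the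
bound for every η > 0, ε ≠ 0, m ≥ 0, and every anisotropic polynomially-dressed Källén–Lehmann
weight positive on the 16 continued shells has degree ≥ 8 and saturates |x|⁻¹⁰ likewise
(PencilRigidity Lemma N, AlternationLemma proved). (B′): (B) with (K)'s conclusion as an extra
hypothesis — the engine below dimension five; intended proof = the picked crux line
boosts-inherit-mirrors (complex planar rotations are boosts once the cone holds; eight-ray
positivity of the doubled Laurent pencils; the parity sieve, proved; level 1 of the level growth IS
(K)).] Assembly: proper-hypercubic + planar rotations of the curvature strings ⇒
(SpeciesProjectionPlanar, PlanarToEuclidean) full E1 of a witness whose other species are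
renormalised to zero, as the Statement allows ⇒ `YangMills`.
Lean: `Summit.QuantumFields.YangMills.Theses.CoincidenceRotationBootstrap.HypercubicLimit ∧ (open
Literature.MathematicalPhysics.QuantumLattice Literature.MathematicalPhysics.AQFT
Literature.MathematicalPhysics.QuantumFieldTheory in let E := EuclideanSpace ℝ (Fin 4); ∀ (G : Type)
[Group G] [TopologicalSpace G] [IsTopologicalGroup G] [CompactSpace G], IsCompactSimpleLieGroup G →
letI : MeasurableSpace G := borel G; haveI : BorelSpace G := ⟨rfl⟩; let W₁ := fun (r : LatticeRep G)
(sch : SpeciesScheme (YMSpecies G)) (S₁ : SchwingerFamily E) => ((∀ (n : ℕ), n ≠ 0 → ∀ (f : Fin n →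
SchwartzMap (E) ℝ) (F : SchwartzMap (Fin n → E) ℂ), IsTensorOf F (fun i => ofRealTest (f i)) →
IsOffDiagonal F → Filter.Tendsto (fun k : ℕ => ((latticeSchwinger r.ρ sch (fun s => s.F) k n (fun _
=> r.curvature) f : ℝ) : ℂ)) Filter.atTop (nhds (S₁ n F))) ∧ (S₁.toLabelled.IsNormalized ∧
S₁.toLabelled.IsHermitian ∧ S₁.toLabelled.HasLinearGrowth ∧ S₁.toLabelled.IsReflectionPositive ∧
S₁.toLabelled.IsSymmetric ∧ S₁.toLabelled.HasClusterProperty) ∧ (∀ (n : ℕ) (a : E) (F : SchwartzMap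
(Fin n → E) ℂ), IsOffDiagonal F → S₁ n (translateMulti a F) = S₁ n F) ∧ (∀ (R : E ≃ₗᵢ[ℝ] E),
LinearMap.det (R.toLinearEquiv : E →ₗ[ℝ] E) = 1 → (∀ i : Fin 4, ∃ j : Fin 4, R
(EuclideanSpace.single i 1) = EuclideanSpace.single j 1 ∨ R (EuclideanSpace.single i 1) =
-EuclideanSpace.single j 1) → ∀ (n : ℕ) (F : SchwartzMap (Fin n → E) ℂ), IsOffDiagonal F → S₁ n
(linActMulti R F) = S₁ n F) ∧ (∃ Δ : ℝ, 0 < Δ ∧ S₁.toLabelled.HasMassGap Δ ∧ HasLatticeMassGap r sch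
Δ)); ∀ (r : LatticeRep G) (sch : SpeciesScheme (YMSpecies G)) (S₁ : SchwingerFamily E), W₁ r sch S₁
→ ∀ (R : E ≃ₗᵢ[ℝ] E) (a b : ℝ), a ^ 2 = 1 / 2 → b ^ 2 = 1 / 2 → R (EuclideanSpace.single 0 1) = a •
EuclideanSpace.single 0 1 + b • EuclideanSpace.single 1 1 → (SchwingerFamily.toLabelled (fun n =>
(S₁ n).comp (linActMulti R))).IsReflectionPositive) ∧ (open
Literature.MathematicalPhysics.QuantumLattice Literature.MathematicalPhysics.AQFT
Literature.MathematicalPhysics.QuantumFieldTheory in let E := EuclideanSpace ℝ (Fin 4); ∀ (S :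
SchwingerFamily E), S.toLabelled.HasLinearGrowth → S.toLabelled.IsSymmetric → (∀ (n : ℕ) (a : E) (F
: SchwartzMap (Fin n → E) ℂ), IsOffDiagonal F → S n (translateMulti a F) = S n F) → (∀ (R : E ≃ₗᵢ[ℝ]
E) (a b : ℝ), a ^ 2 + b ^ 2 = 1 → (a = 0 ∨ b = 0 ∨ a ^ 2 = b ^ 2) → R (EuclideanSpace.single 0 1) =
a • EuclideanSpace.single 0 1 + b • EuclideanSpace.single 1 1 → (SchwingerFamily.toLabelled (fun n
=> (S n).comp (linActMulti R))).IsReflectionPositive) → ∀ (n m : ℕ) (F : SchwartzMap (Fin n → E) ℂ)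
(G : SchwartzMap (Fin m → E) ℂ), IsTimeOrdered F → IsTimeOrdered G → ∃ Φ : ℂ × ℂ → ℂ,
DifferentiableOn ℂ Φ {w : ℂ × ℂ | |w.2.im| < w.1.re} ∧ (∀ (t b : ℝ), 0 < t → ∀ H : SchwartzMap (Fin
(n + m) → E) ℂ, IsAppendTensorOf H (osAdjoint F) (translateMulti (t • EuclideanSpace.single 0 1 + b
• EuclideanSpace.single 1 1) G) → Φ ((t : ℂ), (b : ℂ)) = S (n + m) H) ∧ (∀ w ∈ {w : ℂ × ℂ | |w.2.im|
< w.1.re}, ∀ (HF : SchwartzMap (Fin (n + n) → E) ℂ) (HG : SchwartzMap (Fin (m + m) → E) ℂ),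
IsAppendTensorOf HF (osAdjoint F) F → IsAppendTensorOf HG (osAdjoint G) G → ‖Φ w‖ ^ 2 ≤ ‖S (n + n)
HF‖ * ‖S (m + m) HG‖)) ∧ (open Literature.MathematicalPhysics.QuantumLattice
Literature.MathematicalPhysics.AQFT Literature.MathematicalPhysics.QuantumFieldTheory in let E :=
EuclideanSpace ℝ (Fin 4); ∀ (G : Type) [Group G] [TopologicalSpace G] [IsTopologicalGroup G]
[CompactSpace G], IsCompactSimpleLieGroup G → letI : MeasurableSpace G := borel G; haveI :
BorelSpace G := ⟨rfl⟩; let W₁ := fun (r : LatticeRep G) (sch : SpeciesScheme (YMSpecies G)) (S₁ :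
SchwingerFamily E) => ((∀ (n : ℕ), n ≠ 0 → ∀ (f : Fin n → SchwartzMap (E) ℝ) (F : SchwartzMap (Fin n
→ E) ℂ), IsTensorOf F (fun i => ofRealTest (f i)) → IsOffDiagonal F → Filter.Tendsto (fun k : ℕ =>
((latticeSchwinger r.ρ sch (fun s => s.F) k n (fun _ => r.curvature) f : ℝ) : ℂ)) Filter.atTop (nhds
(S₁ n F))) ∧ (S₁.toLabelled.IsNormalized ∧ S₁.toLabelled.IsHermitian ∧ S₁.toLabelled.HasLinearGrowth
∧ S₁.toLabelled.IsReflectionPositive ∧ S₁.toLabelled.IsSymmetric ∧ S₁.toLabelled.HasClusterProperty)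
∧ (∀ (n : ℕ) (a : E) (F : SchwartzMap (Fin n → E) ℂ), IsOffDiagonal F → S₁ n (translateMulti a F) =
S₁ n F) ∧ (∀ (R : E ≃ₗᵢ[ℝ] E), LinearMap.det (R.toLinearEquiv : E →ₗ[ℝ] E) = 1 → (∀ i : Fin 4, ∃ j :
Fin 4, R (EuclideanSpace.single i 1) = EuclideanSpace.single j 1 ∨ R (EuclideanSpace.single i 1) =
-EuclideanSpace.single j 1) → ∀ (n : ℕ) (F : SchwartzMap (Fin n → E) ℂ), IsOffDiagonal F → S₁ n
(linActMulti R F) = S₁ n F) ∧ (∃ Δ : ℝ, 0 < Δ ∧ S₁.toLabelled.HasMassGap Δ ∧ HasLatticeMassGap r sch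
Δ)); ∀ (r : LatticeRep G) (sch : SpeciesScheme (YMSpecies G)) (S₁ : SchwingerFamily E), W₁ r sch S₁
→ (∀ (R : E ≃ₗᵢ[ℝ] E) (a b : ℝ), a ^ 2 + b ^ 2 = 1 → (a = 0 ∨ b = 0 ∨ a ^ 2 = b ^ 2) → R
(EuclideanSpace.single 0 1) = a • EuclideanSpace.single 0 1 + b • EuclideanSpace.single 1 1 →
(SchwingerFamily.toLabelled (fun n => (S₁ n).comp (linActMulti R))).IsReflectionPositive) → (∀ (n m
: ℕ) (F : SchwartzMap (Fin n → E) ℂ) (G : SchwartzMap (Fin m → E) ℂ), IsTimeOrdered F →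
IsTimeOrdered G → ∃ Φ : ℂ × ℂ → ℂ, DifferentiableOn ℂ Φ {w : ℂ × ℂ | |w.2.im| < w.1.re} ∧ (∀ (t b :
ℝ), 0 < t → ∀ H : SchwartzMap (Fin (n + m) → E) ℂ, IsAppendTensorOf H (osAdjoint F) (translateMulti
(t • EuclideanSpace.single 0 1 + b • EuclideanSpace.single 1 1) G) → Φ ((t : ℂ), (b : ℂ)) = S₁ (n +
m) H) ∧ (∀ w ∈ {w : ℂ × ℂ | |w.2.im| < w.1.re}, ∀ (HF : SchwartzMap (Fin (n + n) → E) ℂ) (HG :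
SchwartzMap (Fin (m + m) → E) ℂ), IsAppendTensorOf HF (osAdjoint F) F → IsAppendTensorOf HG
(osAdjoint G) G → ‖Φ w‖ ^ 2 ≤ ‖S₁ (n + n) HF‖ * ‖S₁ (m + m) HG‖)) → ∀ (R : E ≃ₗᵢ[ℝ] E),
LinearMap.det (R.toLinearEquiv : E →ₗ[ℝ] E) = 1 → R (EuclideanSpace.single 2 1) =
EuclideanSpace.single 2 1 → R (EuclideanSpace.single 3 1) = EuclideanSpace.single 3 1 → ∀ (n : ℕ) (F
: SchwartzMap (Fin n → E) ℂ), IsOffDiagonal F → S₁ n (linActMulti R F) = S₁ n F)`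

## Assembly
Pure logic, PROVED sorry-free as `assembly_provable : Assembly` in the planner's SketchAssembly.lean
(lean check rc 0; axioms propext, Classical.choice, Quot.sound): fix G; HypercubicLimit gives (r,
sch, S); CurvatureChannel gives W₁ and the four axis frames for the curvature channel S₁;
DiagonalMirrorRPR (fed the whole package W₁) gives the four diagonal frames, hence all eight (case
split a = 0 ∨ b = 0 ∨ a² = b², linarith for a² = b² = 1/2); PlanarSpectralCone gives the cone;
CurvatureBoostCovariance gives planar-rotation invariance of the curvature strings;
SpeciesProjectionPlanar produces (r', sch', S') with the HypercubicLimit clauses and planar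
invariance of every string; PlanarToEuclidean upgrades proper-hypercubic + planar to every det-1
isometry, so S'.IsEuclideanInvariant = ⟨translations, rotations⟩; T := ⟨S', E0, E0', E1, E2, E3, E4⟩
: OSData (YMSpecies G) 4 has T.schwinger = S' definitionally and IsYangMillsFor, IsNontrivial,
IsNonGaussian, HasMassGap, HasLatticeMassGap are the clauses in hand. MirrorTransport is consumed
inside CurvatureChannel, not in the chain.

Rationale: WHY THIS LINE. After Osterwalder–Schrader reconstruction along e₀ a Euclidean rotation of the
(x₀,x₁)-plane is a Lorentz boost at imaginary rapidity, and boosts are the one spacetime symmetry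
that Tomita–Takesaki theory manufactures from positivity alone: Borchers1992 (a standard subspace
with lightlike half-sided translations of positive generator has Δ^(it)U(a)Δ^(−it) = U(Λ(−2πt)a) —
no rotation input), Wiesbrock1993, Borchers1996 Thm 4.10, BrunettiGuidoLongo2002, BuchholzEtAl2000,
Kuckert1997 (Poincaré group from wedge modular data). Imported areas: algebraic QFT / modular
localization of standard subspaces (the engine), and several complex variables — the
Siciak–Zaharjuta cross theorem (JarnickiPflug2011) — for the light cone: the two DIAGONAL mirrors of
a coordinate plane, across which Wilson's plaquette action is reflection positive (card
sixteen-mirrors-o4-rigidity, lemma P1; FrohlichIsraelLiebSimon1978 cone argument with the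
Schur-positive kernel exp((β/N)Re tr(g h†))), bound exactly the Euclidean shadow {x₀ > |x₁|} of the
Minkowski wedge, and their two Laplace representations are separate holomorphy on a cross whose
envelope {|arg u| + |arg u'| < π/2} is, at Re x₁ = 0, precisely the light cone |Im x₁| < Re x₀ (new
here; the card left K2 'open even for Gaussians'). Correction to the card, found while typing: E1 as
typed (`IsEuclideanInvariant`, labels untransformed) says every species is an SO(4)-SCALAR, and no
model-blind statement delivers that — the single species s = Σ_μ :(∂_μφ)⁴: of the free field is RP
across all 16 mirrors as typed, W(B₄)-invariant, has the spectral cone and a boost-covariant local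
net, and ⟨ss⟩ is not rotation invariant; the card's subspaces V_i only see two-point data and its
'quarter-turn pin' has no operator meaning. Hence the engine is stated for the CURVATURE CHANNEL tr
F² of the Wilson limit — at dimension 4 a W(B₄)-scalar is an O(4)-scalar (LuscherWeisz1985: the
first hypercubic-only scalar Σ_μ tr(D_μF_μν)² has dimension 6) — and the other species are
renormalised to zero (SpeciesProjectionPlanar), the same species bookkeeping as route
CoincidenceRotationBootstrap, whose existence crux HypercubicLimit is shared verbatim so that one
proof serves both. Versus the open E1 lines: CoincidenceRotationBootstrap needs an emergent rational
rotation, sixteen-mirrors-o4-rigidity bets on two-point Stieltjes rigidity R₄ plus an n-point step,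
FourMirrorsWardE1 (QCD) on Ward identities; here no two-point lemma and no RG — the light cone is a
two-mirror theorem target and the boosts come out of the vacuum's modular structure; negatives
index: one entry, this route's own first filing of (D) (DiagonalMirrorRP, typing defect S₁ 0 free,
repaired as DiagonalMirrorRPR). JUDGE REPAIR 2026-08-16: the species-scalarity input is no longer
prose inside the engine but a TYPED crux, (K) CurvatureKernelBound — the tr F² two-point kernel lies
strictly below the |x|⁻¹⁰ threshold ('dimension < 5'), the one UV inequality that every recorded
anisotropic 16-RP witness saturates (retriage zoo (1+εe₂(p_μ²)²)/(p²+m²); the falsifier (Σ∂_μ⁴)²G_m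
of card sixteen-mirrors-o4-rigidity) — shared verbatim with the sibling route PencilRigidity, which
spends the same datum on two-point shell rigidity (ShellRigidity → NPointIsotropy); here it feeds
the complex-boost parity sieve of (B′) SoftKernelBoostCovariance instead, so the two routes stay
distinct mechanisms over one shared UV input.

RANKED CRUXES. #0 Target (target) — X = HypercubicLimit ∧ DiagonalMirrorRPR ∧ PlanarSpectralCone ∧
CurvatureBoostCovariance as in § Thesis. (why it might fail: inherits HypercubicLimit (existence +
uniform gap, the open core); (B) rests on the typed UV datum (K) CurvatureKernelBound — an output of
the open UV construction — and on (B′), whose sieve has no engine at level ≥ 2; (D) bets on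
torus/free-box b.c.-insensitivity.) [JaffeWitten2000, Borchers1992, OsterwalderSchrader1975]
#2 CurvatureBoostCovariance (crux) — (B) THE ENGINE, BUNDLED PARENT (card K3 → Borchers → K1,
corrected; since 2026-08-16 = KernelBoundEngineGlue applied to (K) CurvatureKernelBound and (B′)
SoftKernelBoostCovariance, which `closes` consumes; kept verbatim because the lead prover's
registered skeleton and six landed Negative lemma files name it). For every compact simple G,
lattice representation r, sequential scheme sch and one-species Schwinger family S₁ on ℝ⁴ carrying
the curvature-channel package W₁ (the IsYangMillsFor convergence of the renormalised action-density
strings to S₁; E0, E0', E2, E3, E4 of S₁.toLabelled; translation invariance on ⁰𝒮; invariance under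
the proper signed permutations; a continuum gap S₁.HasMassGap Δ and the uniform lattice gap
HasLatticeMassGap r sch Δ, Δ > 0): if S₁ is reflection positive in pull-back form for every frame R
whose time axis R e₀ is one of the eight unit normals ±e₀, ±e₁, (±e₀±e₁)/√2 of the mirror lines of
the (x₀,x₁)-plane, and has the planar spectral cone (verbatim the conclusion of PlanarSpectralCone),
then S₁ is invariant on ⁰𝒮 under every determinant-one linear isometry fixing e₂ and e₃ (all
rotations of the (x₀,x₁)-plane, all n-point functions). Intended proof: e₀-reconstruction; cone ⇒
lightlike half-sided translations with positive generator and wedge Reeh–Schlieder for W₁ = {x₁ >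
|t|}; wedge locality (Euclidean source: E3 + slit analyticity across the diagonal mirrors) ⇒ Ω
standard for the polynomial algebra of S₁-fields in W₁; Borchers1992 / BrunettiGuidoLongo2002 ⇒
Δ^(is)U(a)Δ^(−is) = U(Λ₁(−2πs)a), edge translations commute; geometric action of the modular groups
of the three axis wedges (W(B₃)-orbit) closes without central extension to a covariant unitary
representation of P↑₊ (Borchers1996 Thm 4.10, BuchholzEtAl2000, Kuckert1997); tr F², the unique
reflection-even gauge-invariant field of dimension 4 (equivalently the trace anomaly channel), is
covariant under it; boost-invariant Wightman functions continue to Schwinger functions invariant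
under the planar rotations (OsterwalderSchrader1973 §4.2 backwards, BHW). [deps: PlanarSpectralCone,
DiagonalMirrorRPR] [difficulty: XL] (why it might fail: model-blind core FALSE — the zoo Ĉ =
(1+εe₂(p_μ²)²)/(p²+m²) is 16-RP, coned, gapped, anisotropic (GaierYngvason2000: for GFFs geometric
modular action ⇔ Lorentz covariance; net covariance ≠ scalarity of the species); true only through
the typed UV datum (K), which the zoo violates (kernel ε h₈(x̂)|x|⁻¹⁰), and the engineless level ≥ 2
of the sieve of (B′).) [Borchers1992, Borchers1996, BrunettiGuidoLongo2002, BuchholzEtAl2000,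
Kuckert1997, Yngvason1994, GaierYngvason2000, BisognanoWichmann1975, Mund2001, LuscherWeisz1985,
OsterwalderSchrader1973, Haag1996]
#2 SoftKernelBoostCovariance (crux) — (B′) THE ENGINE BELOW DIMENSION FIVE (judge repair
2026-08-16): (B) with one extra hypothesis inserted after the cone — the two-point function of S₁ on
⁰𝒮 is a real kernel K(x₀−x₁), continuous off 0, with |K(x)| ≤ C(1+|x|^(η−10)), η > 0 (verbatim the
conclusion of (K)) — and the same conclusion (invariance of every S₁ n on ⁰𝒮 under each det-1
isometry fixing e₂, e₃). No longer refuted model-blind by the zoo; with a radial soft kernel every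
Gaussian objection is void, and in the Borchers class of generalised free fields an anisotropic
W(B₄)-scalar component has dimension ≥ 5 (Σ_μ∂_μ⁴φ) and is seen by the bound. Intended proof = the
picked crux line Cruxes/CurvatureBoostCovariance/Lines/boosts-inherit-mirrors (complex planar
rotation by iχ = boost with H_χ = cosh χ·H + sinh χ·P₁ ≥ 0 once the cone holds, so e₀- and 45°-frame
RP are inherited by complex-rotated doubled configurations; orbit functions θ ↦ 𝔖(R_θ·(ΘF*⊗G)) are
trigonometric polynomials in e^{4iθ} by quarter turn + temperedness + Paley–Wiener; their Laurent
pencils are PSD on both half-lines s = ±e^{−4χ}; the parity sieve — PROVED, Sieve.paritySieve —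
kills every layer once the level growth is bounded; LEVEL 1 of that growth IS the kernel hypothesis
via the nearest-axis-frame cap, level ≥ 2 is the open G_a), alternative lines
anisotropy-costs-a-dimension (one-field Bisognano–Wichmann from a boost-invariant two-point measure
by KMS uniqueness) and one-field-cocycle-pinning. [deps: PlanarSpectralCone, DiagonalMirrorRPR,
CurvatureKernelBound] [difficulty: XL] (why it might fail: only level 1 of the sieve is the kernel
bound; levels ≥ 2 have no engine, and a 16-RP coned gapped NON-Gaussian family with soft radial
two-point kernel but anisotropic S₄ would refute it; multi-slot OS continuation without E1 is
unbuilt.) [GaierYngvason2000, Borchers1992, BrunettiGuidoLongo2002, OsterwalderSchrader1975,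
GlimmJaffe1987, LuscherWeisz1985, arXiv:1802.09037, doi:10.1063/1.1703798, KravchukQiaoRychkov2021]
#3 CurvatureKernelBound (crux) — (K) THE TYPED SCALARITY HYPOTHESIS ON tr F², shared verbatim with
route PencilRigidity (item CurvatureKernelBound, stmt-QuantumFields-11687; one proof serves both):
for every compact simple G, r, sch and S₁ carrying W₁ there are a real kernel K, continuous on ℝ⁴∖0,
and C, η > 0 with |K(x)| ≤ C(1+|x|^(η−10)) representing S₁ 2 on off-diagonal tests (integrable
integrands) — 'tr F² has dimension < 5' (expected |x|⁻⁸log⁻², two powers of slack; degenerate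
inhabitants of W₁ give K = 0 or κ²). PROVABLY EXCLUDES the (1+εe₂²)/(p²+m²) witness class: that
kernel is (4π²)⁻¹[|x|⁻² + ε h₈(x̂)|x|⁻¹⁰] + O(|x|⁻⁸|log|x||), h₈ := |x|¹⁸·e₂(∂²)²|x|⁻² a nonzero
harmonic octic (exact rational computation, planner zoo_kernel.py: h₈(e₀) = 235008, h₈((1,1,1,1)/2)
= 27648, h₈((2,1,0,0)/√5) = −2101.2; e₂² ∉ (p²) since e₁,…,e₄ are algebraically independent), so the
bound fails for every η > 0, ε ≠ 0, m ≥ 0; every anisotropic polynomially-dressed Källén–Lehmann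
weight positive on the 16 continued shells has degree ≥ 8 and saturates |x|⁻¹⁰ likewise
(PencilRigidity Lemma N; AlternationLemma proved). [deps: HypercubicLimit] [difficulty:
open-problem] (why it might fail: W₁ fixes neither the scaling of c_k nor asymptotic freedom:
singularity order and off-origin continuity of the renormalised tr F² kernel are outputs of the open
UV construction; a gapped Wilson limit with kernel ~|x|⁻¹⁰ obeys W₁ and violates it.)
[JaffeWitten2000, Balaban1989LargeFieldII, MagnenRivasseauSeneor1993, KravchukQiaoRychkov2021,
LuscherWeisz1985, OsterwalderSeiler1978, MontvayMunster1994]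
#3 PlanarSpectralCone (crux) — (C) MODEL-BLIND (card K2, 'planar spectral condition'). For a
one-species Schwinger family S on ℝ⁴ with E0' (linear growth) and E3 (symmetry), translation
invariant on ⁰𝒮, whose pull-back S∘R satisfies the tree's E2 for every frame R with R e₀ ∈ {a e₀ + b
e₁ : a² + b² = 1, a = 0 ∨ b = 0 ∨ a² = b²} (reflection positivity across the four mirror lines x₀ =
0, x₁ = 0, x₀ = ±x₁, both sides): for all time-ordered F (n points) and G (m points) there is Φ
holomorphic on {(ζ,β) ∈ ℂ² : |Im β| < Re ζ} with Φ(t,b) = 𝔖_(n+m)(ΘF* ⊗ G_(t e₀ + b e₁)) for t > 0,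
b ∈ ℝ (any tensor witness) and ‖Φ(ζ,β)‖² ≤ ‖𝔖_(2n)(ΘF* ⊗ F)‖·‖𝔖_(2m)(ΘG* ⊗ G)‖ on the domain — i.e.
⟨Ψ_F, e^(−ζH+iβP₁)Ψ_G⟩ exists as a contraction family, spec(H,P₁) ⊂ {E ≥ |p₁|} on the OS space
(speed of light exactly 1, forced by the 45° mirrors). Intended proof: the two DIAGONAL reflection
positivities give Laplace representations in u = (x₀+x₁)/√2 and u' = (x₀−x₁)/√2 with the partner
coordinate as a real parameter, i.e. separate holomorphy on the cross (ℝ₊ × H) ∪ (H × ℝ₊); the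
Siciak–Zaharjuta cross theorem (relative extremal function (2/π)|arg| of ℝ₊ in the half-plane;
JarnickiPflug2011) extends to {|arg u| + |arg u'| < π/2}, which contains (x₀,x₁) = (t, iσ) exactly
for |σ| < t; Phragmén–Lindelöf with the E2 Cauchy–Schwarz bounds on the edges gives the norm bound;
Paley–Wiener in t → ∞ gives spectral support. [difficulty: L] (why it might fail: Axis RP alone
fails (product-OU, e1-counterexample-zoo Z1: flat shell E ≡ m); the cross theorem gives holomorphy,
but the UNIFORM contraction bound on the whole cone domain needs edge growth control for
distributions (smearing in spectator variables) and may cost an ε of opening angle.)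
[OsterwalderSchrader1973, OsterwalderSchrader1975, GlimmJaffe1987, JarnickiPflug2011,
FrohlichIsraelLiebSimon1978, arXiv:1802.09037]
#4 DiagonalMirrorRPR (crux) — (D) YM-SPECIFIC, REPAIRED 2026-08-15 (first filing DiagonalMirrorRP,
stmt-9665, left S₁ 0 free — convergence only for n ≠ 0, no E0 — so S₁ 0 := −δ over the zero scheme
gave a degree-0 E2 term −1: refuted-misstated by
Theorems.MirrorModularBoostsDiagonalMirrorRP_refuted; negation kept as support NotDiagonalMirrorRP).
For every compact simple G, r, sch and one-species S₁ carrying the curvature-channel package W₁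
(verbatim the hypothesis of CurvatureBoostCovariance / output of CurvatureChannel: lattice
convergence of the renormalised action-density strings to S₁ on ⁰𝒮; E0, E0', E2(e₀), E3, E4;
translations and proper signed permutations on ⁰𝒮; continuum gap and uniform lattice gap Δ > 0): S₁
is reflection positive in pull-back form for every frame R with R e₀ = a e₀ + b e₁, a² = b² = 1/2
(the four oriented diagonal mirrors x₀ = ±x₁). E0 pins the degree-0 term; the conclusion reads S₁
only at n = 0 and on ⁰𝒮 (off-diagonal real tensors total), all fixed by W₁; β ≡ 0 schemes give
constant-field limits κⁿ∫F on ⁰𝒮 (a plaquette product with pairwise distinct base points integrates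
to 0 at its lexicographically minimal vertex), diagonally RP — a counterexample now needs a genuine
gapped Wilson limit. Intended proof: sixteen-mirrors lemma P1 (a plaquette cut by a diagonal mirror
has its diagonal IN the mirror, U_p = P₊(θP₊)†; exp((β/N)Re tr(g h†)) is a Schur-positive kernel ⇒
FILS cone argument ⇒ diagonal RP of Wilson's measure on free swap-symmetric boxes, every β ≥ 0,
volume, closed G ⊂ U(N)); tori carry NO diagonal mirror pair, so torus expectations are compared
with free-box ones at physical scale (b.c.-insensitivity from uniform clustering along β_k); RP is
closed under limits. [deps: CurvatureChannel] [difficulty: M] (why it might fail: no finite 4-torus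
carries the diagonal mirror pair; moving free-box diagonal RP to the torus limit needs
b.c.-insensitivity — uniqueness of the infinite-volume state along β_k → ∞ — which uniform torus
clustering suggests but does not literally give.) [FrohlichIsraelLiebSimon1978,
OsterwalderSeiler1978, Seiler1982, doi:10.1103/physrevd.30.455, JaffeWitten2000, MontvayMunster1994]
#5 HypercubicLimit (crux) — (H) SHARED VERBATIM with route CoincidenceRotationBootstrap (item
HypercubicLimit, stmt-QuantumFields-8646; one proof serves both): for every compact simple G there
are r, sch and a labelled Schwinger family S of ALL gauge-invariant lattice observables with every
clause of `YangMills` except the rotation half of E1 — E0, E0', E2, E3, E4, translation invariance,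
proper hypercubic invariance W(B₄)∩SO(4) (isometries permuting ±e_i, det 1), the IsYangMillsFor
convergence of Wilson's lattice theory along sch, non-triviality and non-Gaussianity of the
curvature species, the continuum and the uniform lattice mass gap. Isotropy is OUTPUT here.
[difficulty: open-problem] (why it might fail: It is the Millennium existence-and-gap problem minus
rotations: tightness of renormalised tr F² correlators along a Wilson scheme and a mass gap uniform
in the volume are both open (Bałaban stops at UV stability; JaffeWitten2000 §6).) [JaffeWitten2000,
Balaban1989LargeFieldII, BalabanEtAl1984, MagnenRivasseauSeneor1993, OsterwalderSeiler1978,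
Seiler1982]
#9 CurvatureChannel (support) — RESTRICTION + TRANSPORT (provable now): if (r, sch, S) satisfies the
HypercubicLimit clauses then the curvature channel S₁ n := S n (constant string r.curvature)
satisfies W₁ — the lattice convergence of the curvature strings, E0/E0'/E2/E3/E4 of S₁.toLabelled
(label specialisation; HasLinearGrowth with T = {r.curvature}), translations, proper hypercubic
invariance, the gaps (HasMassGap by `HasMassGap.restrict`) — AND is reflection positive in pull-back
form for every frame R with R e₀ = a e₀ + b e₁, a² + b² = 1, a = 0 ∨ b = 0 (E2 transported by the
proper signed permutations e₀ ↦ ±e₀, ±e₁ via MirrorTransport; frames sharing the time axis are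
equivalent). [difficulty: provable-now] [OsterwalderSchrader1973,
Literature.MathematicalPhysics.QuantumFieldTheory.OSData,
Literature.MathematicalPhysics.AQFT.LabelledSchwingerFamily.HasMassGap.restrict]
#9 MirrorTransport (support) — MODEL-BLIND BOOKKEEPING used inside CurvatureChannel (not in the
assembly chain): if a one-species family S on ℝ⁴ is invariant on ⁰𝒮 under a linear isometry g and
its pull-back by the frame R₀ is reflection positive, then its pull-back by ANY frame R₁ with R₁ e₀
= g(R₀ e₀) is reflection positive — linActMulti (R₀.trans g) = linActMulti g ∘ linActMulti R₀ on ⁰𝒮,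
and two frames with the same time axis differ by an isometry fixing e₀, which preserves
IsTimeOrdered and commutes with the OS adjoint. [difficulty: provable-now] [OsterwalderSchrader1973,
GlimmJaffe1987]
#9 SpeciesProjectionPlanar (support) — SPECIES BOOKKEEPING (the planar analogue of
CoincidenceRotationBootstrap.SpeciesProjection, provable now): if G admits (r, sch, S) with the
HypercubicLimit clauses and planar-rotation-invariant curvature strings, then G admits (r, sch', S')
with the same clauses and planar-rotation invariance of EVERY species string — sch' = sch with c_s =
m_s = 0 for s ≠ r.curvature and S' n k := S n k if all k i = r.curvature, else 0 (lattice
correlators with a zero factor vanish; E2 of S' is E2 of S on the all-curvature sub-list;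
HasLatticeMassGap does not see c, m). The Statement renormalises non-scalar species to 0
(YangMillsOS docstring; JaffeWitten2000 §4 fn. 1); HasLatticeMassGap keeps the all-observable teeth.
[difficulty: provable-now] [JaffeWitten2000,
Literature.MathematicalPhysics.QuantumFieldTheory.IsYangMillsFor, OsterwalderSeiler1978]
#9 PlanarToEuclidean (support) — EXACT GROUP THEORY, any label type (provable now): invariance on ⁰𝒮
under the proper signed permutations and under every determinant-one isometry fixing e₂, e₃ implies
invariance under every determinant-one linear isometry of ℝ⁴ — the invariance set is a subgroup of E
≃ₗᵢ E (IsOffDiagonal is preserved); conjugating SO(2)₀₁ by proper signed permutations (e.g. (e₁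
e₂)(e₃ ↦ −e₃)) gives SO(2)_μν for all six coordinate planes; Givens rotations generate SO(4)
exactly, no closure or density needed. [difficulty: provable-now] [OsterwalderSchrader1973,
Haag1996]
#9 NotDiagonalMirrorRP (support) — ¬(DiagonalMirrorRP as first typed), rfl-equal to the negation of
the dropped decl; provable now by the landed witness (retarget
Theorems.MirrorModularBoostsDiagonalMirrorRP_refuted); filed because the drop that clears BROKEN
removes the refuted `def` from the file. Not in the assembly chain. [difficulty: provable-now]
#9 KernelBoundEngineGlue (support) — GLUE of the foreseen split of the engine: CurvatureKernelBound
→ SoftKernelBoostCovariance → CurvatureBoostCovariance, by name; pure logic (planner Sketch.lean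
`kernelBoundEngineGlue_provable`, rc 0, 0 sorries); since rev 13 `closes` INLINES this implication
(a support may not be a hypothesis of the deciding theorem), so the item is documentary and provable
now, not load-bearing. Filed flat because `route edit --split` is reserved to final-cycle seats.
[difficulty: provable-now] [OsterwalderSchrader1975]

TWO-LAYER PLAN. CurvatureBoostCovariance ⇐ CurvatureKernelBound → SoftKernelBoostCovariance →
CurvatureBoostCovariance (k = 2) — DONE 2026-08-16 (judge repair) as flat items + the glue support
KernelBoundEngineGlue, `closes` consuming (K) and (B′) directly (the glue inlined since rev 13) and
deriving (B) (`route edit --split` is reserved to final-cycle seats): the YM-specific input the kill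
criteria demanded of the first split is (K), 'tr F² has dimension < 5' in kernel form. The
model-blind split foreseen at open, AxisWedgeStandardness → ModularBoostCovariance, is RETIRED as
such (model-blind-dead: the zoo is a GaierYngvason2000 generalised free field — wedge modular groups
exist but do not move tr F² as a scalar); its operator-algebraic / complex-boost content now lives
in the stub layer of the crux lines of the engine (Cruxes/CurvatureBoostCovariance/Lines:
boosts-inherit-mirrors PICKED — stub_tieRegularity, stub_planarCone = 9664, stub_orbitBandlimit,
stub_rayPositivity, stub_levelGrowth, stub_doubledToInvariant, composition sorry-free —,
anisotropy-costs-a-dimension, one-field-cocycle-pinning), attached with --supports, never items.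
MILESTONE support still foreseen: SpectrumLorentzInvariant (card P0) — from axis-wedge standardness
alone Borchers' relations make the joint spectral measure class of (H, P⃗) SO↑(3,1)-invariant
(glueball shells are exact mass hyperboloids); no scalarity needed. PlanarSpectralCone ⇐
CrossHolomorphy (two diagonal RPs ⇒ holomorphy on {|arg u| + |arg u'| < π/2}, pure SCV) →
ConeContraction (Phragmén–Lindelöf + Paley–Wiener) → PlanarSpectralCone (k = 2). DiagonalMirrorRPR ⇐
WilsonDiagonalRP (free boxes, every β; sixteen-mirrors P1, Lean core `Matrix.PosSemidef` of [exp(c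
Re tr(g_i g_j†))]) → TorusFreeInsensitivity (uniform gap ⇒ b.c.-insensitivity of local correlators)
→ DiagonalMirrorRPR (k = 2).

KILL CRITERIA. A model-blind counterexample to PlanarSpectralCone — a translation-invariant
one-species family, RP in the eight plane frames, with spectral mass at |p₁| > E — closes the route
`refuted:PlanarSpectralCone` and kills card K2 and the support form of R₄ of
sixteen-mirrors-o4-rigidity at once. DiagonalMirrorRPR refuted SUBSTANTIVELY (a gapped Wilson limit
whose curvature channel violates diagonal RP — b.c. sensitivity; NOT the 2026-08-15 typing-defect
refutation of the first filing, repaired) ⇒ pivot: restate (H)∧(D) as one existence crux over free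
swap-symmetric boxes. CurvatureBoostCovariance and SoftKernelBoostCovariance as typed can only be
refuted through a YM limit; the model-blind core of the bundled (B) is dead (the retriage refuter's
W(B₄)-symmetric Gaussian Ĉ = (1+εe₂(p_μ²)²)/(p²+m²): RP in all 16 mirrors, coned, gapped,
anisotropic), that of (B′) is NOT refuted — and cannot be by any Wick polynomial of generalised free
fields (an anisotropic W(B₄)-scalar component has dimension ≥ 5 and is seen by the kernel bound) nor
by a d = 4 lattice scalar (Gaussian scaling limits, AizenmanDuminilCopinAnnals2021): a genuinely
non-Gaussian 16-RP, coned, gapped family with two-point kernel below |x|⁻¹⁰ and an anisotropic S_n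
kills (B′) model-blind ⇒ close `exhausted` unless the level growth G_a (a ≥ 2) is typed as a further
YM input and survives. CurvatureKernelBound refuted (a gapped Wilson limit whose tr F² kernel is ≥
|x|⁻¹⁰ or discontinuous off 0) breaks this engine and PencilRigidity alike ⇒ repair only by a softer
typed UV datum that still excludes the zoo (two-point UV degree < 10 on dilated tensors,
`HasTwoPointUVDegreeLtTen` of line anisotropy-costs-a-dimension), else close
`refuted:CurvatureKernelBound`. HypercubicLimit refuted kills every lattice route alike. E1 proved
by CoincidenceRotationBootstrap or a sixteen-mirrors route ⇒ close `superseded`.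

NOT DECOMPOSED YET. The complex-boost / operator-algebraic layer of (B′) — multi-slot OS
continuation without E1, eight-ray positivity, the orbit band-limit, the level growth G_a for a ≥ 2
(one squeezed pair of tr F² insertions costs at most its dimension), one-field Bisognano–Wichmann by
KMS uniqueness over OSReconstructionNoE1 / AQFT.StandardSubspace — is the crux lines' stub layer
(--supports), deliberately not items (two layers only). The dim-6 hypercubic admixture Σ_μ
tr(D_μF_μν)² is now excluded by the typed (K), not by prose. The SCV cross lemma behind
PlanarSpectralCone and the lattice diagonal-RP lemma + torus/free comparison behind
DiagonalMirrorRPR remain foreseen children. UV stability and the gap: HypercubicLimit is shared and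
undivided here; (K) is the one extra UV datum asked of whoever proves it (prover line on stmt-11687
active, stubs AxisEnvelope/AxialGrowth/…).

CHEAPEST FALSIFIER. The Gaussian, d = 2 case of PlanarSpectralCone: is there a translation-invariant
covariance K(t,x), RP across the four lines t = 0, x = 0, t = ±x from both sides, whose e₀-spectral
measure charges {|p| > E}? By hand (opening session, NOTES.md): Z1 = e^(−m(|t|+|x|)) and EVERY
symmetric separable completely-monotone mixture ∫e^(−a|t|−b|x|)dν(a,b) FAIL diagonal RP (after
Fourier transform in u = (t+x)/√2 the v-dependence is e^(±ikv) × Laplace transforms of push-forwards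
of ν to disjoint half-lines, never a positive Laplace transform unless ν = 0), consistent with the
cross-theorem sketch; the retriage refuter's D₄-symmetric non-separable Gaussian Ĉ =
(1+ε(p₀²p₁²)²)/(p²+1) is RP across all four lines AND has the cone (numerics rp_check2.py), so this
falsifier is unlikely to fire. The engine's model-blind kill (the zoo) is now ABSORBED by (K): zoo
kernel = (4π²)⁻¹[|x|⁻² + εh₈(x̂)|x|⁻¹⁰] + …, h₈(e₀) = 235008 ≠ 0 (planner zoo_kernel.py, exact
rational arithmetic, seconds). Live cheap checks, from the picked line: (i) on the zoo compute the n
= 1+1 doubled Laurent pencil Σ p_k s^k explicitly and confirm PSD on BOTH half-lines with harmonic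
content {0, ±8}, p_{±2} ≠ 0 at level 1 (what (K) must and does forbid); (ii) the nearest-axis-frame
cap must kill k = ±8 for a radial kernel |x|^(−9.5) and fail for |x|^(−10.5); (iii) the massive free
field's doubled orbit function at n = m = 1 must be constant. No cheap model-blind falsifier of (B′)
is known (see KILL CRITERIA: every explicit 16-RP family in d = 4 is Gaussian-generated). Lookup
falsifier: Jakobczyk1993 (acq-02333 pending) — if wedge duality is derived there from Euclidean data
WITHOUT rotations, the axis-wedge standardness step of the lines drops to known.

NUMBERS. Mirrors: 16 = 4 coordinate + 12 diagonal hyperplanes of W(B₄) (roots ±e_μ, ±e_μ±e_ν;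
|W(B₄)| = 384); per coordinate plane 4 lines, 8 oriented unit normals (a,b), a² + b² = 1, a = 0 ∨ b
= 0 ∨ a² = b². Cone: |arg u| + |arg u'| < π/2 ⇔ |Im x₁| < Re x₀ at Re x₁ = 0 ⇔ speed of light
exactly 1. Borchers: Δ^(it)U(a)Δ^(−it) = U(e^(∓2πt)a) on the two lightlike edges. Dimension count:
reflection-even gauge-invariant W(B₄)-scalars of dimension ≤ 4 = span{1, tr F²} (tr FF̃ is
reflection-odd); of the three dimension-6 operators one, Σ_μ tr(D_μF_μν)², is hypercubic-only
(LuscherWeisz1985). UV exponents: tr F² kernel −8 (log⁻²), threshold of (K) −10 + η, zoo kernel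
exactly −10 (= −2 − 8 derivatives; angular profile h₈, harmonic of degree 8: h₈(e₀) = 235008,
h₈((1,1,1,1)/2) = 27648, sign change at (2,1,0,0)/√5: −2101.2). Items: 10 at open; 11 active after
the 2026-08-15 repair; 14 active after the 2026-08-16 judge repair (target, assembly, 6 cruxes — B,
B′, K, C, D, H; closes consumes exactly K, B′, C, D, H since rev 13 — glue inlined, proved supports
used through their landed proofs —, 6 supports) + the dropped refuted record.

DEFINITION REQUESTS. Both requests filed at open have LANDED:
`Literature.MathematicalPhysics.QuantumFieldTheory.OSReconstructionNoE1` (OS Hilbert space, vacuum,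
e^(−tH), U(a⃗), field vectors and the joint spectral measure of (H, P⃗) of a LabelledSchwingerFamily
from E2 + translation invariance on ⁰𝒮 only; one named SNAG fact `exists_isJointSpectralMeasure`)
and `Literature.MathematicalPhysics.AQFT.StandardSubspace` (Tomita operator on Mathlib's
StandardSubspace, axiomatised `ModularData`, named facts `Borchers_oneParticle`,
`Wiesbrock_oneParticle`, `IsHalfSidedModularInclusion`; uniqueness of modular data proved). The
2026-08-16 judge repair needed no definition either: (K) is typed over ContinuousOn, ‖·‖^(η−10) and
MeasureTheory.Integrable, (B′) over the same vocabulary as (B). The fourteen active items need no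
further definition.

Novelty: Searches (2026-08-15): `lit search --source crossref "From Euclidean field theory to quantum field
theory Schlingemann modular"` (10; doi:10.1142/s0129055x99000362 found and READ as
arXiv:hep-th/9802035 pp. 1, 6, 9: invariance under the full continuous E(d) is axiom 3); `lit search
--source crossref "half-sided modular inclusions translations positive energy Borchers standard
subspace Poincare group wedge"` (12: Borchers1996 doi:10.1007/bf02100104, Wiesbrock1993, Araki–Zsidó
2005, Borchers LMP 1998 ×2); `lit search --source crossref "Bisognano-Wichmann theorem Euclidean
field theory reflection positivity derivation local symmetric semigroup"` (12: Jakobczyk1993,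
Mund2001, Gottschalk JMP 2002); `lit search --source crossref "Kuckert uniqueness Unruh effect PCT
symmetry modular symmetries localization regions"` (Kuckert1997, CMP 2000, CMP 2001); `lit search
--source crossref "particle structure Euclidean lattice field theories energy momentum spectrum
dispersion reflection positivity Barata Fredenhagen"` (9: Barata–Fredenhagen CMP 1991; Gantumur JHEP
07 (2026) 036 'rotationally invariant dynamical lattice regulators' — regulator side, not RP-based);
`lit frontier QuantumFields --since 2020` (30 rows; arXiv:2606.19362, arXiv:2605.18787; nothing on
modular theory or E1 from RP); `lit galaxy search "Bisognano-Wichmann" --star all` (31 rows: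
Haag1996, Kuckert ESI-589 (1998), Rigotti CMP 1978, OWR 50/2023 'Standard subspaces in QFT'; no
lattice / Euclidean-limit use); `lit search …  [refs: 10.1142/s0129055x99000362, 10.1007/bf02100104, hep-th/9802035, 2606.19362, 2605.18787, doi:10.1142/s0129055x99000362, doi:10.1007/bf02100104, Borchers1996, Wiesbrock1993, Jakobczyk1993, Mund2001, Kuckert1997, Haag1996, Schlingemann1999, Borchers1992, BrunettiGuidoLongo2002, BuchholzEtAl2000, GaierYngvason2000, Yngvason1994, JarnickiPflug2011]

Barriers (technique_class: modular-localization, multi-mirror-rp, separate-analyticity): - technique_class: modular-localization, multi-mirror-rp, separate-analyticity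
- Literature.Barriers.QuantumFields.RegularisationDichotomy: evaded — E1 is recovered in the LIMIT
of one reflection-positive regulator from positivity the lattice does have (16 mirrors); no
Euclid-invariant comparison cutoff and no uniqueness/Borel-summability argument, which is the
barrier's 'only printed general device'.
- Literature.Barriers.QuantumFields.ImprovedActionPositivityViolation: respected and load-bearing —
DiagonalMirrorRP needs Wilson's unimproved plaquette action exactly as the Statement hard-codes it
(1×2 loops of improved actions cross diagonal mirrors without the C·θC̄ structure); improvement and
this route are alternatives, not allies.
- Literature.Barriers.QuantumFields.UVStabilityNonUniqueness: orthogonal — every hypothesis of the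
engine (RP in 16 mirrors, proper hypercubic invariance, translations, the cone) is a closed
condition inherited by every subsequential limit (ruling Y2); uniqueness of the limit is never used.
- Literature.Barriers.QuantumFields.HaagTheorem: consistent — no interaction picture and no
free-field identification at sharp time; the boosts are modular automorphisms of the interacting
vacuum's own OS space.
- Literature.Barriers.QuantumFields.PerturbativeInvisibility: not in class (nothing is expanded in g
or in a); conceded that the scalarity step for tr F² inside the engine is where canonical power
counting of the dimension-6 hypercubic operator enters

History (route lifecycle, newest last):
- 2026-08-15T16:48:56Z · REPAIRED (drop DiagonalMirrorRP; add NotDiagonalMirrorRP) — back to open: repair step 2/2: drop the refuted DiagonalMirrorRP (stmt-QuantumFields-9665) from the active set — it is no longer load-bearing: closes (certified rev 3: lean r (planner-rrefute-QuantumFields-MirrorModularBoo-1e0539f7-g4-0)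
- 2026-08-15T16:51:49Z · rev 5: restated Target (stmt-QuantumFields-9662) — repair follow-up: Target restated by decl name (H ∧ D_R ∧ C ∧ B) — the original inlined Target carried the refuted DiagonalMirrorRP text as a conjunct (false as (planner-rrefute-QuantumFields-MirrorModularBoo-1e0539f7-g4-0)
- 2026-08-15T17:05:32Z · rev 7: dropped Target — repair follow-up: drop the by-name Target stmt-QuantumFields-11164 (rank 0) — it can never render: rank 0 is placed before the four cruxes it names, so the gate (planner-rrefute-QuantumFields-MirrorModularBoo-1e0539f7-g5-0)
- 2026-08-16T18:01:17Z · rev 16: restated Target (stmt-QuantumFields-11335) — route-repair follow-up (statement-revised p116790): Target re-typed by name with the weak-coupling existence leg — X = WeakCouplingHypercubicLimit ∧ DiagonalMir (planner-rrepair-QuantumFields-MirrorModularBoo-6c2bb906-0)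
- 2026-08-17T17:27:06Z · rev 18: restated Assembly (stmt-QuantumFields-10707 proved) — hygiene after the 8646 route-choice: restate the stale Assembly (stmt-10707, pre-re-type chain through HypercubicLimit; its landed proof `unfold Assembly; exact (planner-rchoice-QuantumFields-MirrorModularBoo-cd617af1-0)
- 2026-08-25T13:24:02Z · DORMANT — reconciler: no traction for 7.7 d (last activity item-evidence-added at 2026-08-17T19:15:50Z); parked, not closed — `ledger route dormant route-QuantumFields-Mi (operator:999:1790452)
- 2026-08-28T19:25:54Z · REACTIVATED — reconciler: reactivated — activity statement-closed at 2026-08-28T16:05:03Z after parking at 2026-08-25T13:24:02Z (operator:999:2723797)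
- 2026-08-31T13:47:14Z · rev 19: restated Assembly (stmt-QuantumFields-18786 proved), Target (stmt-QuantumFields-16195) — FOLD (shape F): +WeakCouplingHypercubicLimitRP (crux r5); Assembly+Target by name; closes minus hDiag — kit 31ee6172 + trim O4W4 (operator:999:4094315)

sub-problem: YangMills · status: open · opened planner-plancard-QuantumFields-YangMills-mirr-3e3a6046-0 2026-08-15T14:09:24Z · rev 20 · ledger route-QuantumFields-MirrorModularBoosts
GENERATED by the gate from the ledger (D-0016/17). Provers cite these decls: `theorem foo : Summit.QuantumFields.YangMills.Theses.MirrorModularBoosts.<Decl> := …` in Summits/QuantumFields/YangMills/Theorems/<Name>.lean.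
-/

namespace Summit.QuantumFields.YangMills.Theses.MirrorModularBoosts

open scoped BigOperators Topology Manifold Classical MeasureTheory ProbabilityTheory Matrix InnerProductSpace ComplexConjugate ContinuousMap
open Filter Set Function TopologicalSpace MeasureTheory

attribute [summit_statement] _root_.YangMills

/-- item stmt-QuantumFields-14999 · crux · rank 2 · open · by planner
why it might fail: Only level 1 of the sieve is the kernel bound: levels ≥ 2 (one squeezed pair among 2a insertions) have no engine, and a 16-RP coned gapped NON-Gaussian family with soft radial two-point kernel but anisotropic S₄ would refute it; multi-slot OS continuation without E1 is unbuilt.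
sources: GaierYngvason2000, Borchers1992, BrunettiGuidoLongo2002, OsterwalderSchrader1975, GlimmJaffe1987, LuscherWeisz1985
[crux] (B′) THE ENGINE BELOW DIMENSION FIVE — second half of the foreseen split of the engine, glue
item KernelBoundEngineGlue : CurvatureKernelBound → SoftKernelBoostCovariance →
CurvatureBoostCovariance (judge repair 2026-08-16: the parent engine with the typed scalarity
hypothesis made explicit; filed flat because `route edit --split` is reserved to final-cycle seats).
For every compact simple G, r, sch and one-species S₁ carrying W₁, reflection positive in pull-back
form in the eight planar frames R e₀ ∈ {±e₀, ±e₁, (±e₀±e₁)/√2}, with the planar spectral cone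
(verbatim the conclusion of PlanarSpectralCone) AND whose two-point function on ⁰𝒮 is a real kernel
K(x₀−x₁), continuous off 0, with |K(x)| ≤ C(1+|x|^(η−10)), η > 0 (verbatim the conclusion of
CurvatureKernelBound): every S₁ n is invariant on ⁰𝒮 under each determinant-one isometry fixing e₂
and e₃. The extra hypothesis is what the Gaussian zoo Ĉ = (1+εe₂(p_μ²)²)/(p²+m²) violates (kernel ~
ε h₈(x̂)|x|⁻¹⁰), so this statement is no longer refuted model-blind by it; with a radial soft kernel
every Gaussian objection is void (radial covariance ⇒ O(4)-invariant Gaussian), and in the Borchers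
class of (generalised) free fields an -/
@[route_item "route-QuantumFields-MirrorModularBoosts", crux (experiment := "instrument: 6→v17 4585b6d0 REV-PASS (registration worded) · ⟨18372⟩ v5→v6 3460a91f REV-PASS (worded) · ⟨17721⟩ reverted + ONE hand minted on `stub_thre…") (source := "director HOURLY-YM l.2157, 2026-09-01")]
def SoftKernelBoostCovariance : Prop :=
  open Literature.MathematicalPhysics.QuantumLattice Literature.MathematicalPhysics.AQFT Literature.MathematicalPhysics.QuantumFieldTheory in let E := EuclideanSpace ℝ (Fin 4); ∀ (G : Type) [Group G] [TopologicalSpace G] [IsTopologicalGroup G] [CompactSpace G], IsCompactSimpleLieGroup G → letI : MeasurableSpace G := borel G; haveI : BorelSpace G := ⟨rfl⟩; let W₁ := fun (r : LatticeRep G) (sch : SpeciesScheme (YMSpecies G)) (S₁ : SchwingerFamily E) => ((∀ (n : ℕ), n ≠ 0 → ∀ (f : Fin n → SchwartzMap (E) ℝ) (F : SchwartzMap (Fin n → E) ℂ), IsTensorOf F (fun i => ofRealTest (f i)) → IsOffDiagonal F → Filter.Tendsto (fun k : ℕ => ((latticeSchwinger r.ρ sch (fun s => s.F) k n (fun _ =>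 r.curvature) f : ℝ) : ℂ)) Filter.atTop (nhds (S₁ n F))) ∧ (S₁.toLabelled.IsNormalized ∧ S₁.toLabelled.IsHermitian ∧ S₁.toLabelled.HasLinearGrowth ∧ S₁.toLabelled.IsReflectionPositive ∧ S₁.toLabelled.IsSymmetric ∧ S₁.toLabelled.HasClusterProperty) ∧ (∀ (n : ℕ) (a : E) (F : SchwartzMap (Fin n → E) ℂ), IsOffDiagonal F → S₁ n (translateMulti a F) = S₁ n F) ∧ (∀ (R : E ≃ₗᵢ[ℝ] E), LinearMap.det (R.toLinearEquiv : E →ₗ[ℝ] E) = 1 → (∀ i : Fin 4, ∃ j : Fin 4, R (EuclideanSpace.single i 1) = EuclideanSpace.single j 1 ∨ R (EuclideanSpace.single i 1) = -EuclideanSpace.single j 1) → ∀ (n : ℕ) (F : SchwartzMap (Fin n → E) ℂ), IsOffDiagonal F → S₁ n (linActMulti R F) = S₁ n F) ∧ (∃ Δ : ℝ, 0 < Δ ∧ S₁.toLabelled.HasMassGap Δ ∧ HasLatticeMassGap r sch Δ)); ∀ (r : LatticeRep G) (sch : SpeciesScheme (YMSpecies G)) (S₁ : SchwingerFamily E), W₁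 r sch S₁ → (∀ (R : E ≃ₗᵢ[ℝ] E) (a b : ℝ), a ^ 2 + b ^ 2 = 1 → (a = 0 ∨ b = 0 ∨ a ^ 2 = b ^ 2) → R (EuclideanSpace.single 0 1) = a • EuclideanSpace.single 0 1 + b • EuclideanSpace.single 1 1 → (SchwingerFamily.toLabelled (fun n => (S₁ n).comp (linActMulti R))).IsReflectionPositive) → (∀ (n m : ℕ) (F : SchwartzMap (Fin n → E) ℂ) (G : SchwartzMap (Fin m → E) ℂ), IsTimeOrdered F → IsTimeOrdered G → ∃ Φ : ℂ × ℂ → ℂ, DifferentiableOn ℂ Φ {w : ℂ × ℂ | |w.2.im| < w.1.re} ∧ (∀ (t b : ℝ), 0 < t → ∀ H : SchwartzMap (Fin (n + m) → E) ℂ, IsAppendTensorOf H (osAdjoint F) (translateMulti (t • EuclideanSpace.single 0 1 + b • EuclideanSpace.single 1 1) G) → Φ ((t : ℂ), (b : ℂ)) = S₁ (n + m) H) ∧ (∀ w ∈ {w : ℂ × ℂ | |w.2.im| < w.1.re}, ∀ (HF : SchwartzMap (Fin (n + n) → E) ℂ) (HG : SchwartzMap (Fin (m + m) → E) ℂ),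 IsAppendTensorOf HF (osAdjoint F) F → IsAppendTensorOf HG (osAdjoint G) G → ‖Φ w‖ ^ 2 ≤ ‖S₁ (n + n) HF‖ * ‖S₁ (m + m) HG‖)) → (∃ (K : E → ℝ) (C η : ℝ), 0 < η ∧ ContinuousOn K {x : E | x ≠ 0} ∧ (∀ x : E, x ≠ 0 → |K x| ≤ C * (1 + ‖x‖ ^ (η - 10))) ∧ ∀ F : SchwartzMap (Fin 2 → E) ℂ, IsOffDiagonal F → MeasureTheory.Integrable (fun x : Fin 2 → E => (K (x 0 - x 1) : ℂ) * F x) ∧ S₁ 2 F = ∫ x : Fin 2 → E, (K (x 0 - x 1) : ℂ) * F x) → ∀ (R : E ≃ₗᵢ[ℝ] E), LinearMap.det (R.toLinearEquiv : E →ₗ[ℝ] E) = 1 → R (EuclideanSpace.single 2 1) = EuclideanSpace.single 2 1 → R (EuclideanSpace.single 3 1) = EuclideanSpace.single 3 1 → ∀ (n : ℕ) (F : SchwartzMap (Fin n → E) ℂ), IsOffDiagonal F → S₁ n (linActMulti R F) = S₁ n F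

/-- item stmt-QuantumFields-11687 · crux · rank 3 · open · by planner
why it might fail: W₁ fixes neither the scaling of c_k nor asymptotic freedom: the singularity ORDER (below |x|⁻¹⁰) and off-origin continuity of the renormalised tr F² kernel are outputs of the open UV construction; a gapped Wilson limit with kernel ~|x|⁻¹⁰ obeys W₁ and violates it.
sources: JaffeWitten2000, Balaban1989LargeFieldII, MagnenRivasseauSeneor1993, KravchukQiaoRychkov2021, LuscherWeisz1985, OsterwalderSeiler1978
[crux] card K4 (the only UV datum; tr F² has dimension 4 < 5): for every compact simple G, r, sch
and one-species S₁ carrying W₁, there are a REAL kernel K : ℝ⁴ → ℝ, continuous on ℝ⁴∖0, and C, η > 0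
with |K(x)| ≤ C(1 + |x|^(η−10)) (expected |x|⁻⁸·log^γ near 0; bounded at infinity by clustering)
such that for every off-diagonal two-point test function F the integrand K(x₀−x₁)F(x₀,x₁) is
integrable and S₁ 2 F = ∫ K(x₀ − x₁) F(x₀,x₁) dx₀dx₁. Reality is the limit of the real lattice
correlations; continuity off 0 is the joint regularity the 16 Laplace representations suggest.
Degenerate inhabitants of W₁ (zero scheme: K = 0; constant-field limits: K = κ²) satisfy it. [deps:
HypercubicLimit] [difficulty: open-problem] -/
@[route_item "route-QuantumFields-MirrorModularBoosts", crux]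
def CurvatureKernelBound : Prop :=
  open Literature.MathematicalPhysics.QuantumLattice Literature.MathematicalPhysics.AQFT Literature.MathematicalPhysics.QuantumFieldTheory in let E := EuclideanSpace ℝ (Fin 4); ∀ (G : Type) [Group G] [TopologicalSpace G] [IsTopologicalGroup G] [CompactSpace G], IsCompactSimpleLieGroup G → letI : MeasurableSpace G := borel G; haveI : BorelSpace G := ⟨rfl⟩; let W₁ := fun (r : LatticeRep G) (sch : SpeciesScheme (YMSpecies G)) (S₁ : SchwingerFamily E) => ((∀ (n : ℕ), n ≠ 0 → ∀ (f : Fin n → SchwartzMap (E) ℝ) (F : SchwartzMap (Fin n → E) ℂ), IsTensorOf F (fun i => ofRealTest (f i)) → IsOffDiagonal F → Filter.Tendsto (fun k : ℕ => ((latticeSchwinger r.ρ sch (fun s => s.F) k n (fun _ => r.curvature) f : ℝ) : ℂ)) Filter.atTop (nhds (S₁ n F))) ∧ (S₁.toLabelled.IsNormalized ∧ S₁.toLabelled.IsHermitian ∧ S₁.toLabelled.HasLinearGrowth ∧ S₁.toLabelled.IsReflectionPositive ∧ S₁.toLabelled.IsSymmetric ∧ S₁.toLabelled.HasClusterProperty)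 ∧ (∀ (n : ℕ) (a : E) (F : SchwartzMap (Fin n → E) ℂ), IsOffDiagonal F → S₁ n (translateMulti a F) = S₁ n F) ∧ (∀ (R : E ≃ₗᵢ[ℝ] E), LinearMap.det (R.toLinearEquiv : E →ₗ[ℝ] E) = 1 → (∀ i : Fin 4, ∃ j : Fin 4, R (EuclideanSpace.single i 1) = EuclideanSpace.single j 1 ∨ R (EuclideanSpace.single i 1) = -EuclideanSpace.single j 1) → ∀ (n : ℕ) (F : SchwartzMap (Fin n → E) ℂ), IsOffDiagonal F → S₁ n (linActMulti R F) = S₁ n F) ∧ (∃ Δ : ℝ, 0 < Δ ∧ S₁.toLabelled.HasMassGap Δ ∧ HasLatticeMassGap r sch Δ)); ∀ (r : LatticeRep G) (sch : SpeciesScheme (YMSpecies G)) (S₁ : SchwingerFamily E), W₁ r sch S₁ → ∃ (K : E → ℝ) (C η : ℝ), 0 < η ∧ ContinuousOn K {x : E | x ≠ 0} ∧ (∀ x : E, x ≠ 0 → |K x| ≤ C * (1 + ‖x‖ ^ (η - 10))) ∧ ∀ F : SchwartzMap (Fin 2 → E) ℂ, IsOffDiagonal F → MeasureTheory.Integrable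 (fun x : Fin 2 → E => (K (x 0 - x 1) : ℂ) * F x) ∧ S₁ 2 F = ∫ x : Fin 2 → E, (K (x 0 - x 1) : ℂ) * F x

/-- item stmt-QuantumFields-9664 · crux · rank 3 · closed · proved by Summit.QuantumFields.YangMills.Cruxes.PlanarSpectralCone.PositivityDiscToOperatorCone.PlanarSpectralCone_of @ c67cfeede86f (prover) · by planner
why it might fail: No E1 and RP only on frame-time-ordered supports: multi-time analyticity and density of cone-ordered vectors must come from E0' alone (OS II sans rotations), and pushing disc→strip→spec(H,P₁)⊂cone to ALL time-ordered F,G may force an ε-smaller cone or smeared form; axis RP alone fails (product-OU).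
sources: OsterwalderSchrader1973, OsterwalderSchrader1975, JarnickiPflug2011, GlimmJaffe1987, doi:10.1007/bf01611501, arXiv:1201.6003
[crux] (C) MODEL-BLIND (card K2, 'planar spectral condition'). For a one-species Schwinger family S
on ℝ⁴ with E0' (linear growth) and E3 (symmetry), translation invariant on ⁰𝒮, whose pull-back S∘R
satisfies the tree's E2 for every frame R with R e₀ ∈ {a e₀ + b e₁ : a² + b² = 1, a = 0 ∨ b = 0 ∨ a²
= b²} (reflection positivity across the four mirror lines x₀ = 0, x₁ = 0, x₀ = ±x₁, both sides): for
all time-ordered F (n points) and G (m points) there is Φ holomorphic on {(ζ,β) ∈ ℂ² : |Im β| < Re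
ζ} with Φ(t,b) = 𝔖_(n+m)(ΘF* ⊗ G_(t e₀ + b e₁)) for t > 0, b ∈ ℝ (any tensor witness) and ‖Φ(ζ,β)‖²
≤ ‖𝔖_(2n)(ΘF* ⊗ F)‖·‖𝔖_(2m)(ΘG* ⊗ G)‖ on the domain — i.e. ⟨Ψ_F, e^(−ζH+iβP₁)Ψ_G⟩ exists as a
contraction family, spec(H,P₁) ⊂ {E ≥ |p₁|} on the OS space (speed of light exactly 1, forced by the
45° mirrors). Intended proof: the two DIAGONAL reflection positivities give Laplace representations
in u = (x₀+x₁)/√2 and u' = (x₀−x₁)/√2 with the partner coordinate as a real parameter, i.e. separate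
holomorphy on the cross (ℝ₊ × H) ∪ (H × ℝ₊); the Siciak–Zaharjuta cross theorem (relative extremal
function (2/π)|arg| of ℝ₊ in the half-plane; JarnickiPflug2011) extends to {|arg u| + |arg u'| <
π/2}, wh -/
@[route_item "route-QuantumFields-MirrorModularBoosts", crux]
def PlanarSpectralCone : Prop :=
  open Literature.MathematicalPhysics.QuantumLattice Literature.MathematicalPhysics.AQFT Literature.MathematicalPhysics.QuantumFieldTheory in let E := EuclideanSpace ℝ (Fin 4); ∀ (S : SchwingerFamily E), S.toLabelled.HasLinearGrowth → S.toLabelled.IsSymmetric → (∀ (n : ℕ) (a : E) (F : SchwartzMap (Fin n → E) ℂ), IsOffDiagonal F → S n (translateMulti a F) = S n F) → (∀ (R : E ≃ₗᵢ[ℝ] E) (a b : ℝ), a ^ 2 + b ^ 2 = 1 → (a = 0 ∨ b = 0 ∨ a ^ 2 = b ^ 2) → R (EuclideanSpace.single 0 1) = a • EuclideanSpace.single 0 1 + b • EuclideanSpace.single 1 1 → (SchwingerFamily.toLabelled (fun n => (S n).comp (linActMulti R))).IsReflectionPositive) → ∀ (n m : ℕ) (F : SchwartzMap (Fin n → E)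 ℂ) (G : SchwartzMap (Fin m → E) ℂ), IsTimeOrdered F → IsTimeOrdered G → ∃ Φ : ℂ × ℂ → ℂ, DifferentiableOn ℂ Φ {w : ℂ × ℂ | |w.2.im| < w.1.re} ∧ (∀ (t b : ℝ), 0 < t → ∀ H : SchwartzMap (Fin (n + m) → E) ℂ, IsAppendTensorOf H (osAdjoint F) (translateMulti (t • EuclideanSpace.single 0 1 + b • EuclideanSpace.single 1 1) G) → Φ ((t : ℂ), (b : ℂ)) = S (n + m) H) ∧ (∀ w ∈ {w : ℂ × ℂ | |w.2.im| < w.1.re}, ∀ (HF : SchwartzMap (Fin (n + n) → E) ℂ) (HG : SchwartzMap (Fin (m + m) → E) ℂ), IsAppendTensorOf HF (osAdjoint F) F → IsAppendTensorOf HG (osAdjoint G) G → ‖Φ w‖ ^ 2 ≤ ‖S (n + n) HF‖ * ‖S (m + m) HG‖)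

-- `PlanarSpectralCone` holds: proved by `Summit.QuantumFields.YangMills.Cruxes.PlanarSpectralCone.PositivityDiscToOperatorCone.PlanarSpectralCone_of` @ c67cfeede86f (its module imports this route file, so no `_holds` link can be stated here).

/-- item stmt-QuantumFields-27395 · crux · rank 5 · open · by operator
why it might fail: It is the 4-d YM construction at weak coupling with a volume-uniform gap (tightness + IR control open; Bałaban stops at UV stability) + diagonal RP of the limit: no finite straight 4-torus carries the diagonal mirror pair, so it needs b.c.-insensitivity / 45°-universality of the witness — unproved.
sources: JaffeWitten2000, Balaban1989LargeFieldII, MagnenRivasseauSeneor1993, OsterwalderSeiler1978, FrohlichIsraelLiebSimon1978, Seiler1982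
[crux] (H_RP — the existence leg at weak coupling WITH diagonal-frame reflection positivity AT ITS
OWN WITNESS; shape F = FOLD of director-ym O4 WORD 1, 2026-08-31; ADDED beside the old crux
`WeakCouplingHypercubicLimit` (stmt-QuantumFields-16154), which stays defined and becomes an aside):
for every compact simple G there exist a lattice representation r, a species scheme sch with
sch.HasWeakCouplingLimit (β_k = 2/g₀² → ∞) and a labelled Schwinger family S on ℝ⁴ such that (NEW
CONJUNCT) the curvature channel n ↦ S n (curvature,…,curvature) is reflection positive in pull-back
form n ↦ S n ∘ linActMulti R for every frame R with R e₀ = a e₀ + b e₁, a² = b² = ½ (the four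
oriented diagonal mirrors x₀ = ±x₁ of THIS witness — not of every W₁ datum), AND all of today's
HypercubicLimit clauses (E0, E0′, E2, E3, E4, translations and proper-hypercubic invariance on ⁰𝒮,
convergence of Wilson's renormalised strings along sch to S, non-triviality and non-Gaussianity of
the curvature species, Δ > 0 with S.HasMassGap Δ and HasLatticeMassGap r sch Δ). H_RP ⟹ H_old (drop
the conjunct); YangMills ⟹ H_RP (kit probe OnPathF: the summit's full SO(4) covariance transports E2
to the diagonal frames — the -/
@[route_item "route-QuantumFields-MirrorModularBoosts", crux]
def WeakCouplingHypercubicLimitRP : Prop :=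
  open Literature.MathematicalPhysics.QuantumLattice Literature.MathematicalPhysics.AQFT Literature.MathematicalPhysics.QuantumFieldTheory in let E := EuclideanSpace ℝ (Fin 4); ∀ (G : Type) [Group G] [TopologicalSpace G] [IsTopologicalGroup G] [CompactSpace G], IsCompactSimpleLieGroup G → letI : MeasurableSpace G := borel G; haveI : BorelSpace G := ⟨rfl⟩; ∃ (r : LatticeRep G) (sch : SpeciesScheme (YMSpecies G)) (S : LabelledSchwingerFamily (YMSpecies G) (E)), sch.HasWeakCouplingLimit ∧ (∀ (R : E ≃ₗᵢ[ℝ] E) (a b : ℝ), a ^ 2 = 1 / 2 → b ^ 2 = 1 / 2 → R (EuclideanSpace.single 0 1) = a • EuclideanSpace.single 0 1 + b • EuclideanSpace.single 1 1 → (SchwingerFamily.toLabelled (fun n => (S n (fun _ => r.curvature)).comp (linActMulti R))).IsReflectionPositive) ∧ (S.IsNormalized ∧ S.IsHermitian ∧ S.HasLinearGrowth ∧ S.IsReflectionPositive ∧ S.IsSymmetric ∧ S.HasClusterProperty ∧ (∀ (n : ℕ) (k : Fin n → YMSpecies G) (a : E) (F : SchwartzMap (Fin n → E) ℂ), IsOffDiagonal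 F → S n k (translateMulti a F) = S n k F) ∧ (∀ (n : ℕ) (k : Fin n → YMSpecies G) (R : E ≃ₗᵢ[ℝ] E), LinearMap.det (R.toLinearEquiv : E →ₗ[ℝ] E) = 1 → (∀ i : Fin 4, ∃ j : Fin 4, R (EuclideanSpace.single i 1) = EuclideanSpace.single j 1 ∨ R (EuclideanSpace.single i 1) = -EuclideanSpace.single j 1) → ∀ F : SchwartzMap (Fin n → E) ℂ, IsOffDiagonal F → S n k (linActMulti R F) = S n k F)) ∧ (∀ (n : ℕ), n ≠ 0 → ∀ (σ : Fin n → YMSpecies G) (f : Fin n → SchwartzMap (E) ℝ) (F : SchwartzMap (Fin n → E) ℂ), IsTensorOf F (fun i => ofRealTest (f i)) → IsOffDiagonal F → Filter.Tendsto (fun k : ℕ => ((latticeSchwinger r.ρ sch (fun s => s.F) k n σ f : ℝ) : ℂ)) Filter.atTop (nhds (S n σ F))) ∧ (∃ (F₁ G₁ : SchwartzMap (Fin 1 → E) ℂ) (H₁ : SchwartzMap (Fin (1 + 1) → E) ℂ), IsTimeOrdered F₁ ∧ IsTimeOrdered G₁ ∧ IsAppendTensorOf H₁ (osAdjoint F₁)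 G₁ ∧ S (1 + 1) (fun _ => r.curvature) H₁ ≠ S 1 (fun _ => r.curvature) (osAdjoint F₁) * S 1 (fun _ => r.curvature) G₁) ∧ (∃ (f g h : SchwartzMap (E) ℂ) (Ffgh : SchwartzMap (Fin 3 → E) ℂ) (Fgh Ffh Ffg : SchwartzMap (Fin 2 → E) ℂ) (Ff Fg Fh : SchwartzMap (Fin 1 → E) ℂ), IsTensorOf Ffgh ![f, g, h] ∧ IsOffDiagonal Ffgh ∧ IsTensorOf Fgh ![g, h] ∧ IsTensorOf Ffh ![f, h] ∧ IsTensorOf Ffg ![f, g] ∧ IsTensorOf Ff ![f] ∧ IsTensorOf Fg ![g] ∧ IsTensorOf Fh ![h] ∧ S 3 (fun _ => r.curvature) Ffgh - S 1 (fun _ => r.curvature) Ff * S 2 (fun _ => r.curvature) Fgh - S 1 (fun _ => r.curvature) Fg * S 2 (fun _ => r.curvature) Ffh - S 1 (fun _ => r.curvature) Fh * S 2 (fun _ => r.curvature) Ffg + 2 * (S 1 (fun _ => r.curvature) Ff * S 1 (fun _ => r.curvature) Fg * S 1 (fun _ => r.curvature) Fh) ≠ 0) ∧ (∃ Δ : ℝ,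 0 < Δ ∧ S.HasMassGap Δ ∧ HasLatticeMassGap r sch Δ)

/-- item stmt-QuantumFields-9663 · aside · rank 2 · open · by planner
why it might fail: = glue(CurvatureKernelBound, SoftKernelBoostCovariance). Model-blind core FALSE (zoo Ĉ=(1+εe₂(p_μ²)²)/(p²+m²): 16-RP, coned, gapped, anisotropic); true only via the typed UV datum CurvatureKernelBound (the zoo violates it: kernel εh₈(x̂)|x|⁻¹⁰) and the engineless level ≥ 2 of the sieve.
sources: GaierYngvason2000, Yngvason1994, BuchholzEtAl2000, Borchers1992, Borchers1996, BrunettiGuidoLongo2002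
[crux] (B) THE ENGINE (card K3 → Borchers → K1, corrected). For every compact simple G, lattice
representation r, sequential scheme sch and one-species Schwinger family S₁ on ℝ⁴ carrying the
curvature-channel package W₁ (the IsYangMillsFor convergence of the renormalised action-density
strings to S₁; E0, E0', E2, E3, E4 of S₁.toLabelled; translation invariance on ⁰𝒮; invariance under
the proper signed permutations; a continuum gap S₁.HasMassGap Δ and the uniform lattice gap
HasLatticeMassGap r sch Δ, Δ > 0): if S₁ is reflection positive in pull-back form for every frame R
whose time axis R e₀ is one of the eight unit normals ±e₀, ±e₁, (±e₀±e₁)/√2 of the mirror lines of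
the (x₀,x₁)-plane, and has the planar spectral cone (verbatim the conclusion of PlanarSpectralCone),
then S₁ is invariant on ⁰𝒮 under every determinant-one linear isometry fixing e₂ and e₃ (all
rotations of the (x₀,x₁)-plane, all n-point functions). Intended proof: e₀-reconstruction; cone ⇒
lightlike half-sided translations with positive generator and wedge Reeh–Schlieder for W₁ = {x₁ >
|t|}; wedge locality (Euclidean source: E3 + slit analyticity across the diagonal mirrors) ⇒ Ω
standard for the polynomial algebra o -/
@[route_item "route-QuantumFields-MirrorModularBoosts", crux]
def CurvatureBoostCovariance : Prop :=
  open Literature.MathematicalPhysics.QuantumLattice Literature.MathematicalPhysics.AQFT Literature.MathematicalPhysics.QuantumFieldTheory in let E := EuclideanSpace ℝ (Fin 4); ∀ (G : Type) [Group G] [TopologicalSpace G] [IsTopologicalGroup G] [CompactSpace G], IsCompactSimpleLieGroup G → letI : MeasurableSpace G := borel G; haveI : BorelSpace G := ⟨rfl⟩; let W₁ := fun (r : LatticeRep G) (sch : SpeciesScheme (YMSpecies G)) (S₁ : SchwingerFamily E) => ((∀ (n : ℕ), n ≠ 0 → ∀ (f : Fin n → SchwartzMap (E) ℝ) (F : SchwartzMap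 (Fin n → E) ℂ), IsTensorOf F (fun i => ofRealTest (f i)) → IsOffDiagonal F → Filter.Tendsto (fun k : ℕ => ((latticeSchwinger r.ρ sch (fun s => s.F) k n (fun _ => r.curvature) f : ℝ) : ℂ)) Filter.atTop (nhds (S₁ n F))) ∧ (S₁.toLabelled.IsNormalized ∧ S₁.toLabelled.IsHermitian ∧ S₁.toLabelled.HasLinearGrowth ∧ S₁.toLabelled.IsReflectionPositive ∧ S₁.toLabelled.IsSymmetric ∧ S₁.toLabelled.HasClusterProperty) ∧ (∀ (n : ℕ) (a : E) (F : SchwartzMap (Fin n → E) ℂ), IsOffDiagonal F → S₁ n (translateMulti a F) = S₁ n F) ∧ (∀ (R : E ≃ₗᵢ[ℝ] E), LinearMap.det (R.toLinearEquiv : E →ₗ[ℝ] E) = 1 → (∀ i : Fin 4, ∃ j : Fin 4, R (EuclideanSpace.single i 1) = EuclideanSpace.single j 1 ∨ R (EuclideanSpace.single i 1) = -EuclideanSpace.single j 1) → ∀ (n : ℕ) (F : SchwartzMap (Fin n → E) ℂ), IsOffDiagonal F → S₁ n (linActMulti R F) = S₁ n F) ∧ (∃ Δ : ℝ, 0 <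 Δ ∧ S₁.toLabelled.HasMassGap Δ ∧ HasLatticeMassGap r sch Δ)); ∀ (r : LatticeRep G) (sch : SpeciesScheme (YMSpecies G)) (S₁ : SchwingerFamily E), W₁ r sch S₁ → (∀ (R : E ≃ₗᵢ[ℝ] E) (a b : ℝ), a ^ 2 + b ^ 2 = 1 → (a = 0 ∨ b = 0 ∨ a ^ 2 = b ^ 2) → R (EuclideanSpace.single 0 1) = a • EuclideanSpace.single 0 1 + b • EuclideanSpace.single 1 1 → (SchwingerFamily.toLabelled (fun n => (S₁ n).comp (linActMulti R))).IsReflectionPositive) → (∀ (n m : ℕ) (F : SchwartzMap (Fin n → E) ℂ) (G : SchwartzMap (Fin m → E) ℂ), IsTimeOrdered F → IsTimeOrdered G → ∃ Φ : ℂ × ℂ → ℂ, DifferentiableOn ℂ Φ {w : ℂ × ℂ | |w.2.im| < w.1.re} ∧ (∀ (t b : ℝ), 0 < t → ∀ H : SchwartzMap (Fin (n + m) → E) ℂ, IsAppendTensorOf H (osAdjoint F) (translateMulti (t • EuclideanSpace.single 0 1 + b • EuclideanSpace.single 1 1) G) → Φ ((t : ℂ), (b : ℂ)) = S₁ (n +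 m) H) ∧ (∀ w ∈ {w : ℂ × ℂ | |w.2.im| < w.1.re}, ∀ (HF : SchwartzMap (Fin (n + n) → E) ℂ) (HG : SchwartzMap (Fin (m + m) → E) ℂ), IsAppendTensorOf HF (osAdjoint F) F → IsAppendTensorOf HG (osAdjoint G) G → ‖Φ w‖ ^ 2 ≤ ‖S₁ (n + n) HF‖ * ‖S₁ (m + m) HG‖)) → ∀ (R : E ≃ₗᵢ[ℝ] E), LinearMap.det (R.toLinearEquiv : E →ₗ[ℝ] E) = 1 → R (EuclideanSpace.single 2 1) = EuclideanSpace.single 2 1 → R (EuclideanSpace.single 3 1) = EuclideanSpace.single 3 1 → ∀ (n : ℕ) (F : SchwartzMap (Fin n → E) ℂ), IsOffDiagonal F → S₁ n (linActMulti R F) = S₁ n F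

-- earlier Target (stmt-QuantumFields-11335, replaced 2026-08-16T18:01:17Z -> stmt-QuantumFields-16195): retired by None — HypercubicLimit ∧ DiagonalMirrorRPR ∧ PlanarSpectralCone ∧ CurvatureBoostCovariance
-- earlier Target (stmt-QuantumFields-16195, replaced 2026-08-31T13:47:14Z -> stmt-QuantumFields-27394): retired by None — WeakCouplingHypercubicLimit ∧ DiagonalMirrorRPR ∧ PlanarSpectralCone ∧ CurvatureBoostCovariance
-- earlier Target (stmt-QuantumFields-9662, replaced 2026-08-15T16:51:49Z -> stmt-QuantumFields-11164): retired by None — (open Literature.MathematicalPhysics.QuantumLattice Literature.MathematicalPhysics.AQFT Literature.MathematicalPhysics.QuantumFieldTheory in let E := EuclideanSpace ℝ (Fin 4); ∀ (G : Type) [Group G] [TopologicalSpace G] [IsTopologicalGroup G] [CompactSpace G], IsCompactSimpleLieGr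
/-- item stmt-QuantumFields-27394 · target · rank 6 · open · by operator
why it might fail: Inherits WeakCouplingHypercubicLimitRP (open core: existence at the asymptotically free point + volume-uniform gap + diagonal RP of the witness); the engine rests on CurvatureKernelBound and SoftKernelBoostCovariance.
sources: JaffeWitten2000, OsterwalderSchrader1975, FrohlichIsraelLiebSimon1978, Borchers1992
[target] X = WeakCouplingHypercubicLimitRP ∧ PlanarSpectralCone ∧ CurvatureBoostCovariance, BY NAME
(rank 6, rendered after the crux it names): the FOLD (shape F) merged (D) into (H) — the existence
leg now carries the diagonal-frame RP of its own witness — so the former conjunct DiagonalMirrorRPR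
(aside) is gone from X. X → YangMills is exactly the re-glued `closes` (K, B′ := engine, C, H_RP; B
from K and B′ by the landed glue). Not in the closes chain. [difficulty: open-problem] -/
@[route_item "route-QuantumFields-MirrorModularBoosts"]
def Target : Prop :=
  WeakCouplingHypercubicLimitRP ∧ PlanarSpectralCone ∧ CurvatureBoostCovariance

/-- item stmt-QuantumFields-10604 · aside · rank 4 · open · by planner
why it might fail: Degeneracy fixed: S₁ 0 was free (hconv only n≠0, no E0) ⇒ z=−1 witness; E0 now sits in W₁, the conclusion reads S₁ only at n=0 and on ⁰𝒮. Real risk: no finite 4-torus has the diagonal mirror pair; free-box diagonal RP must survive the torus limit by b.c.-insensitivity from the uniform gap, unproved.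
sources: FrohlichIsraelLiebSimon1978, OsterwalderSeiler1978, Seiler1982, doi:10.1103/physrevd.30.455, JaffeWitten2000, MontvayMunster1994
[crux] (D) YM-SPECIFIC — REPAIRED DiagonalMirrorRP (stmt-QuantumFields-9665, refuted-misstated by
Summit.QuantumFields.YangMills.Theorems.MirrorModularBoostsDiagonalMirrorRP_refuted: as typed S₁ 0
was unconstrained — lattice convergence was asked only for n ≠ 0 and no E0 — so S₁ 0 := −δ over the
zero scheme made the degree-0 term of E2 equal −1). Now stated over exactly the curvature-channel
package W₁ that CurvatureChannel produces and CurvatureBoostCovariance consumes (convergence of the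
renormalised action-density strings to S₁ on ⁰𝒮 along sch; E0 normalisation + hermiticity, E0', E2
along e₀, E3, E4 of S₁.toLabelled; translations and proper signed permutations on ⁰𝒮; a continuum
gap and the uniform lattice gap HasLatticeMassGap r sch Δ, Δ > 0): for every compact simple G,
lattice representation r, scheme sch and one-species family S₁ with W₁ r sch S₁, S₁ is reflection
positive in pull-back form for every frame R with R e₀ = a e₀ + b e₁, a² = b² = 1/2 (the four
oriented diagonal mirrors x₀ = ±x₁ of the (x₀,x₁)-plane). E0 pins the degree-0 term (|Σ c_j|² ≥ 0)
and every value the conclusion inspects is determined by W₁ (S₁ 0 by E0; S₁ n, n ≥ 1, only on ⁰𝒮 —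
θF*⊗G of time-ordered F -/
@[route_item "route-QuantumFields-MirrorModularBoosts", crux]
def DiagonalMirrorRPR : Prop :=
  open Literature.MathematicalPhysics.QuantumLattice Literature.MathematicalPhysics.AQFT Literature.MathematicalPhysics.QuantumFieldTheory in let E := EuclideanSpace ℝ (Fin 4); ∀ (G : Type) [Group G] [TopologicalSpace G] [IsTopologicalGroup G] [CompactSpace G], IsCompactSimpleLieGroup G → letI : MeasurableSpace G := borel G; haveI : BorelSpace G := ⟨rfl⟩; let W₁ := fun (r : LatticeRep G) (sch : SpeciesScheme (YMSpecies G)) (S₁ : SchwingerFamily E) => ((∀ (n : ℕ), n ≠ 0 → ∀ (f : Fin n → SchwartzMap (E) ℝ) (F : SchwartzMap (Fin n → E) ℂ), IsTensorOf F (fun i => ofRealTest (f i)) → IsOffDiagonal F → Filter.Tendsto (fun k : ℕ => ((latticeSchwinger r.ρ sch (fun s => s.F) k n (fun _ => r.curvature) f : ℝ) : ℂ)) Filter.atTop (nhds (S₁ n F))) ∧ (S₁.toLabelled.IsNormalized ∧ S₁.toLabelled.IsHermitian ∧ S₁.toLabelled.HasLinearGrowth ∧ S₁.toLabelled.IsReflectionPositive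 ∧ S₁.toLabelled.IsSymmetric ∧ S₁.toLabelled.HasClusterProperty) ∧ (∀ (n : ℕ) (a : E) (F : SchwartzMap (Fin n → E) ℂ), IsOffDiagonal F → S₁ n (translateMulti a F) = S₁ n F) ∧ (∀ (R : E ≃ₗᵢ[ℝ] E), LinearMap.det (R.toLinearEquiv : E →ₗ[ℝ] E) = 1 → (∀ i : Fin 4, ∃ j : Fin 4, R (EuclideanSpace.single i 1) = EuclideanSpace.single j 1 ∨ R (EuclideanSpace.single i 1) = -EuclideanSpace.single j 1) → ∀ (n : ℕ) (F : SchwartzMap (Fin n → E) ℂ), IsOffDiagonal F → S₁ n (linActMulti R F) = S₁ n F) ∧ (∃ Δ : ℝ, 0 < Δ ∧ S₁.toLabelled.HasMassGap Δ ∧ HasLatticeMassGap r sch Δ)); ∀ (r : LatticeRep G) (sch : SpeciesScheme (YMSpecies G)) (S₁ : SchwingerFamily E), W₁ r sch S₁ → ∀ (R : E ≃ₗᵢ[ℝ] E) (a b : ℝ), a ^ 2 = 1 / 2 → b ^ 2 = 1 / 2 → R (EuclideanSpace.single 0 1) = a • EuclideanSpace.single 0 1 + b • EuclideanSpace.single 1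 1 → (SchwingerFamily.toLabelled (fun n => (S₁ n).comp (linActMulti R))).IsReflectionPositive

/-- item stmt-QuantumFields-16154 · aside · rank 5 · open · by planner
why it might fail: It is the Millennium existence-and-gap problem minus rotations, now pinned to the Gaussian UV fixed point: tightness of renormalised tr F² correlators as β_k → ∞ (Bałaban stops at UV stability) and a volume-uniform gap are open; a finite-β critical limit no longer qualifies.
sources: JaffeWitten2000, Balaban1989LargeFieldII, BalabanEtAl1984, MagnenRivasseauSeneor1993, OsterwalderSeiler1978, Seiler1982
[crux] the EXISTENCE LEG (imported complement, = YangMills minus rotations under the re-typed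
statement p116790; `YangMills → HypercubicLimit` is proved in the repair planner's Sketch.lean): for
every compact simple G there are r, a sequential scheme sch AT WEAK COUPLING
(sch.HasWeakCouplingLimit: β_k = 2/g₀² → ∞) and a labelled Schwinger family S on ℝ⁴ over YMSpecies G
with E0 (normalisation, hermiticity), E0', E2, E3, E4, translation invariance and proper-hypercubic
invariance on ⁰𝒮, the IsYangMillsFor convergence of Wilson's lattice theory along sch to S,
non-triviality and non-Gaussianity of the curvature species, and Δ > 0 with S.HasMassGap Δ and
HasLatticeMassGap r sch Δ. Every UV+IR route (Bałaban RG, flow-line state space, finite-size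
criterion, curvature/LSI closers) outputs exactly this; this route adds nothing to it and bets on
them. [difficulty: open-problem] -/
@[route_item "route-QuantumFields-MirrorModularBoosts", crux]
def WeakCouplingHypercubicLimit : Prop :=
  open Literature.MathematicalPhysics.QuantumLattice Literature.MathematicalPhysics.AQFT Literature.MathematicalPhysics.QuantumFieldTheory in let E := EuclideanSpace ℝ (Fin 4); ∀ (G : Type) [Group G] [TopologicalSpace G] [IsTopologicalGroup G] [CompactSpace G], IsCompactSimpleLieGroup G → letI : MeasurableSpace G := borel G; haveI : BorelSpace G := ⟨rfl⟩; ∃ (r : LatticeRep G) (sch : SpeciesScheme (YMSpecies G)) (S : LabelledSchwingerFamily (YMSpecies G) (E)), sch.HasWeakCouplingLimit ∧ (S.IsNormalized ∧ S.IsHermitian ∧ S.HasLinearGrowth ∧ S.IsReflectionPositive ∧ S.IsSymmetric ∧ S.HasClusterProperty ∧ (∀ (n : ℕ) (k : Fin n → YMSpecies G) (a : E) (F : SchwartzMap (Fin n → E) ℂ), IsOffDiagonal F → S n k (translateMulti a F) = S n k F) ∧ (∀ (n : ℕ) (k : Fin n → YMSpecies G) (R : E ≃ₗᵢ[ℝ]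 E), LinearMap.det (R.toLinearEquiv : E →ₗ[ℝ] E) = 1 → (∀ i : Fin 4, ∃ j : Fin 4, R (EuclideanSpace.single i 1) = EuclideanSpace.single j 1 ∨ R (EuclideanSpace.single i 1) = -EuclideanSpace.single j 1) → ∀ F : SchwartzMap (Fin n → E) ℂ, IsOffDiagonal F → S n k (linActMulti R F) = S n k F)) ∧ (∀ (n : ℕ), n ≠ 0 → ∀ (σ : Fin n → YMSpecies G) (f : Fin n → SchwartzMap (E) ℝ) (F : SchwartzMap (Fin n → E) ℂ), IsTensorOf F (fun i => ofRealTest (f i)) → IsOffDiagonal F → Filter.Tendsto (fun k : ℕ => ((latticeSchwinger r.ρ sch (fun s => s.F) k n σ f : ℝ) : ℂ)) Filter.atTop (nhds (S n σ F))) ∧ (∃ (F₁ G₁ : SchwartzMap (Fin 1 → E) ℂ) (H₁ : SchwartzMap (Fin (1 + 1) → E) ℂ), IsTimeOrdered F₁ ∧ IsTimeOrdered G₁ ∧ IsAppendTensorOf H₁ (osAdjoint F₁) G₁ ∧ S (1 + 1) (fun _ => r.curvature) H₁ ≠ S 1 (fun _ => r.curvature) (osAdjoint F₁) * S 1 (fun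 _ => r.curvature) G₁) ∧ (∃ (f g h : SchwartzMap (E) ℂ) (Ffgh : SchwartzMap (Fin 3 → E) ℂ) (Fgh Ffh Ffg : SchwartzMap (Fin 2 → E) ℂ) (Ff Fg Fh : SchwartzMap (Fin 1 → E) ℂ), IsTensorOf Ffgh ![f, g, h] ∧ IsOffDiagonal Ffgh ∧ IsTensorOf Fgh ![g, h] ∧ IsTensorOf Ffh ![f, h] ∧ IsTensorOf Ffg ![f, g] ∧ IsTensorOf Ff ![f] ∧ IsTensorOf Fg ![g] ∧ IsTensorOf Fh ![h] ∧ S 3 (fun _ => r.curvature) Ffgh - S 1 (fun _ => r.curvature) Ff * S 2 (fun _ => r.curvature) Fgh - S 1 (fun _ => r.curvature) Fg * S 2 (fun _ => r.curvature) Ffh - S 1 (fun _ => r.curvature) Fh * S 2 (fun _ => r.curvature) Ffg + 2 * (S 1 (fun _ => r.curvature) Ff * S 1 (fun _ => r.curvature) Fg * S 1 (fun _ => r.curvature) Fh) ≠ 0) ∧ (∃ Δ : ℝ, 0 < Δ ∧ S.HasMassGap Δ ∧ HasLatticeMassGap r sch Δ)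

/-- item stmt-QuantumFields-8646 · aside · rank 5 · open · by planner
why it might fail: It is the Millennium existence-and-gap problem minus rotations: tightness of renormalised tr F² correlators along a Wilson scheme (jointly for ALL species, multiplicative renormalisation only) and a mass gap uniform in the volume are both open (Bałaban stops at UV stability; JaffeWitten2000 §6).
sources: JaffeWitten2000, Balaban1989LargeFieldII, BalabanEtAl1984, MagnenRivasseauSeneor1993, OsterwalderSeiler1978, Seiler1982
[crux] the EXISTENCE LEG (imported complement, = YangMills minus rotations; `YangMills →
HypercubicLimit` is proved in the planner's Sketch.lean): for every compact simple G there are r,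
sch and a labelled Schwinger family S on ℝ⁴ over YMSpecies G with E0 (normalisation, hermiticity),
E0', E2, E3, E4, translation invariance and proper-hypercubic invariance on ⁰𝒮, the IsYangMillsFor
convergence of Wilson's lattice theory along sch to S, non-triviality and non-Gaussianity of the
curvature species, and Δ > 0 with S.HasMassGap Δ and HasLatticeMassGap r sch Δ. Every UV+IR route
(Bałaban RG, flow-line state space, finite-size criterion, curvature/LSI closers) outputs exactly
this; this route adds nothing to it and bets on them. [difficulty: open-problem] -/
@[route_item "route-QuantumFields-MirrorModularBoosts", crux]
def HypercubicLimit : Prop :=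
  open Literature.MathematicalPhysics.QuantumLattice Literature.MathematicalPhysics.AQFT Literature.MathematicalPhysics.QuantumFieldTheory in let E := EuclideanSpace ℝ (Fin 4); ∀ (G : Type) [Group G] [TopologicalSpace G] [IsTopologicalGroup G] [CompactSpace G], IsCompactSimpleLieGroup G → letI : MeasurableSpace G := borel G; haveI : BorelSpace G := ⟨rfl⟩; ∃ (r : LatticeRep G) (sch : SpeciesScheme (YMSpecies G)) (S : LabelledSchwingerFamily (YMSpecies G) (E)), (S.IsNormalized ∧ S.IsHermitian ∧ S.HasLinearGrowth ∧ S.IsReflectionPositive ∧ S.IsSymmetric ∧ S.HasClusterProperty ∧ (∀ (n : ℕ) (k : Fin n → YMSpecies G) (a : E) (F : SchwartzMap (Fin n → E) ℂ), IsOffDiagonal F → S n k (translateMulti a F) = S n k F) ∧ (∀ (n : ℕ) (k : Fin n → YMSpecies G) (R : E ≃ₗᵢ[ℝ] E), LinearMap.det (R.toLinearEquiv : E →ₗ[ℝ] E) = 1 → (∀ i : Fin 4, ∃ j : Fin 4, R (EuclideanSpace.single i 1) = EuclideanSpace.single j 1 ∨ R (EuclideanSpace.single i 1) = -EuclideanSpace.single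 j 1) → ∀ F : SchwartzMap (Fin n → E) ℂ, IsOffDiagonal F → S n k (linActMulti R F) = S n k F)) ∧ (∀ (n : ℕ), n ≠ 0 → ∀ (σ : Fin n → YMSpecies G) (f : Fin n → SchwartzMap (E) ℝ) (F : SchwartzMap (Fin n → E) ℂ), IsTensorOf F (fun i => ofRealTest (f i)) → IsOffDiagonal F → Filter.Tendsto (fun k : ℕ => ((latticeSchwinger r.ρ sch (fun s => s.F) k n σ f : ℝ) : ℂ)) Filter.atTop (nhds (S n σ F))) ∧ (∃ (F₁ G₁ : SchwartzMap (Fin 1 → E) ℂ) (H₁ : SchwartzMap (Fin (1 + 1) → E) ℂ), IsTimeOrdered F₁ ∧ IsTimeOrdered G₁ ∧ IsAppendTensorOf H₁ (osAdjoint F₁) G₁ ∧ S (1 + 1) (fun _ => r.curvature) H₁ ≠ S 1 (fun _ => r.curvature) (osAdjoint F₁) * S 1 (fun _ => r.curvature) G₁) ∧ (∃ (f g h : SchwartzMap (E) ℂ) (Ffgh : SchwartzMap (Fin 3 → E) ℂ) (Fgh Ffh Ffg : SchwartzMap (Fin 2 → E) ℂ) (Ff Fg Fh : SchwartzMap (Fin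 1 → E) ℂ), IsTensorOf Ffgh ![f, g, h] ∧ IsOffDiagonal Ffgh ∧ IsTensorOf Fgh ![g, h] ∧ IsTensorOf Ffh ![f, h] ∧ IsTensorOf Ffg ![f, g] ∧ IsTensorOf Ff ![f] ∧ IsTensorOf Fg ![g] ∧ IsTensorOf Fh ![h] ∧ S 3 (fun _ => r.curvature) Ffgh - S 1 (fun _ => r.curvature) Ff * S 2 (fun _ => r.curvature) Fgh - S 1 (fun _ => r.curvature) Fg * S 2 (fun _ => r.curvature) Ffh - S 1 (fun _ => r.curvature) Fh * S 2 (fun _ => r.curvature) Ffg + 2 * (S 1 (fun _ => r.curvature) Ff * S 1 (fun _ => r.curvature) Fg * S 1 (fun _ => r.curvature) Fh) ≠ 0) ∧ (∃ Δ : ℝ, 0 < Δ ∧ S.HasMassGap Δ ∧ HasLatticeMassGap r sch Δ)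

/-- item stmt-QuantumFields-11116 · support · rank 9 · closed · proved by Summit.QuantumFields.YangMills.Theorems.notDiagonalMirrorRP_proof @ 0136809fb2cf (prover) · by planner
sources: Summit.QuantumFields.YangMills.Theorems.MirrorModularBoostsDiagonalMirrorRP_refuted, Literature.MathematicalPhysics.QuantumFieldTheory.isYangMillsFor_vacuum, OsterwalderSchrader1973
[support] NEGATIVE EDGE KEPT COMPILED: ¬(DiagonalMirrorRP as originally typed) — the statement
refuted by Summit.QuantumFields.YangMills.Theorems.MirrorModularBoostsDiagonalMirrorRP_refuted
(stmt-QuantumFields-9665; witness G = SU(2), fundamental r, SpeciesScheme.zero, S₁ 0 := −δ, S₁ n :=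
0, diagonal frame e₀ ↦ (e₀+e₁)/√2: degree-0 E2 term = −1). Filed because clearing BROKEN requires
dropping the refuted item from the route, and the gate renders dropped items as comments only, so
`def DiagonalMirrorRP` leaves this file and the landed Refutation theorem (which names that decl)
stops elaborating — as already happened to FrustratedForces.GPEnergyCeiling and
WarmColdDichotomy.ColdIsRare today. This decl is `rfl`-equal to `¬ DiagonalMirrorRP` (checked before
the drop), so the landed proof closes it verbatim once retargeted (`theorem … :
MirrorModularBoosts.NotDiagonalMirrorRP := by intro h; …`); evidence = that proof. Not in the
assembly chain; provable now. [difficulty: provable-now] -/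
@[route_item "route-QuantumFields-MirrorModularBoosts"]
def NotDiagonalMirrorRP : Prop :=
  ¬ (open Literature.MathematicalPhysics.QuantumLattice Literature.MathematicalPhysics.AQFT Literature.MathematicalPhysics.QuantumFieldTheory in let E := EuclideanSpace ℝ (Fin 4); ∀ (G : Type) [Group G] [TopologicalSpace G] [IsTopologicalGroup G] [CompactSpace G], IsCompactSimpleLieGroup G → letI : MeasurableSpace G := borel G; haveI : BorelSpace G := ⟨rfl⟩; ∀ (r : LatticeRep G) (sch : SpeciesScheme (YMSpecies G)) (S₁ : SchwingerFamily E), (∀ (n : ℕ), n ≠ 0 → ∀ (f : Fin n → SchwartzMap (E) ℝ) (F : SchwartzMap (Fin n → E) ℂ), IsTensorOf F (fun i => ofRealTest (f i)) → IsOffDiagonal F → Filter.Tendsto (fun k : ℕ => ((latticeSchwinger r.ρ sch (fun s => s.F) k n (fun _ => r.curvature) f : ℝ) : ℂ)) Filter.atTop (nhds (S₁ n F))) → ∀ Δ : ℝ, 0 < Δ → HasLatticeMassGap r sch Δ → ∀ (R : E ≃ₗᵢ[ℝ] E) (a b : ℝ), a ^ 2 = 1 / 2 → b ^ 2 = 1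 / 2 → R (EuclideanSpace.single 0 1) = a • EuclideanSpace.single 0 1 + b • EuclideanSpace.single 1 1 → (SchwingerFamily.toLabelled (fun n => (S₁ n).comp (linActMulti R))).IsReflectionPositive)

-- `NotDiagonalMirrorRP` holds: proved by `Summit.QuantumFields.YangMills.Theorems.notDiagonalMirrorRP_proof` @ 0136809fb2cf (its module imports this route file, so no `_holds` link can be stated here).

/-- item stmt-QuantumFields-15000 · support · rank 9 · closed · proved by Summit.QuantumFields.YangMills.Theorems.kernelBoundEngineGlue_proof @ 600f59ff012d (prover) · by planner
sources: OsterwalderSchrader1975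
[support] GLUE of the foreseen split of the engine (judge repair 2026-08-16): CurvatureKernelBound →
SoftKernelBoostCovariance → CurvatureBoostCovariance, BY NAME (rank 9 renders after the three
cruxes). Pure logic — CurvatureKernelBound turns the package W₁ into the kernel triple (K, C, η)
that SoftKernelBoostCovariance asks for on top of W₁, the eight frames and the cone: `intro hKB
hSoft G _ _ _ _ hG; letI := borel G; haveI : BorelSpace G := ⟨rfl⟩; intro W₁ r sch S₁ hW₁ h8 hcone;
exact hSoft G hG r sch S₁ hW₁ h8 hcone (hKB G hG r sch S₁ hW₁)` (planner Sketch.lean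
`kernelBoundEngineGlue_provable`, lean rc 0, 0 sorries, against verbatim copies of the three decls).
Hence closing CurvatureKernelBound (shared with PencilRigidity) and SoftKernelBoostCovariance closes
the parent crux that `closes` consumes; the lead prover's line boosts-inherit-mirrors on the parent
is, logically, a proof of SoftKernelBoostCovariance (its level-1 input is the kernel bound) and may
be retargeted to it. Not in the closes chain. [deps: CurvatureKernelBound,
SoftKernelBoostCovariance, CurvatureBoostCovariance] [difficulty: provable-now] -/
@[route_item "route-QuantumFields-MirrorModularBoosts"]
def KernelBoundEngineGlue : Prop :=
  CurvatureKernelBound → SoftKernelBoostCovariance → CurvatureBoostCovariance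

-- `KernelBoundEngineGlue` holds: proved by `Summit.QuantumFields.YangMills.Theorems.kernelBoundEngineGlue_proof` @ 600f59ff012d (its module imports this route file, so no `_holds` link can be stated here).

/-- item stmt-QuantumFields-9666 · support · rank 9 · closed · proved by Summit.QuantumFields.YangMills.Theorems.curvatureChannel_proof (prover) · by planner
sources: OsterwalderSchrader1973, Literature.MathematicalPhysics.QuantumFieldTheory.OSData, Literature.MathematicalPhysics.AQFT.LabelledSchwingerFamily.HasMassGap.restrict
[support] RESTRICTION + TRANSPORT (provable now): if (r, sch, S) satisfies the HypercubicLimit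
clauses then the curvature channel S₁ n := S n (constant string r.curvature) satisfies W₁ — the
lattice convergence of the curvature strings, E0/E0'/E2/E3/E4 of S₁.toLabelled (label
specialisation; HasLinearGrowth with T = {r.curvature}), translations, proper hypercubic invariance,
the gaps (HasMassGap by `HasMassGap.restrict`) — AND is reflection positive in pull-back form for
every frame R with R e₀ = a e₀ + b e₁, a² + b² = 1, a = 0 ∨ b = 0 (E2 transported by the proper
signed permutations e₀ ↦ ±e₀, ±e₁ via MirrorTransport; frames sharing the time axis are equivalent).
[difficulty: provable-now] -/
@[route_item "route-QuantumFields-MirrorModularBoosts"]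
def CurvatureChannel : Prop :=
  open Literature.MathematicalPhysics.QuantumLattice Literature.MathematicalPhysics.AQFT Literature.MathematicalPhysics.QuantumFieldTheory in let E := EuclideanSpace ℝ (Fin 4); ∀ (G : Type) [Group G] [TopologicalSpace G] [IsTopologicalGroup G] [CompactSpace G], IsCompactSimpleLieGroup G → letI : MeasurableSpace G := borel G; haveI : BorelSpace G := ⟨rfl⟩; let W := fun (r : LatticeRep G) (sch : SpeciesScheme (YMSpecies G)) (S : LabelledSchwingerFamily (YMSpecies G) (E)) => (S.IsNormalized ∧ S.IsHermitian ∧ S.HasLinearGrowth ∧ S.IsReflectionPositive ∧ S.IsSymmetric ∧ S.HasClusterProperty ∧ (∀ (n : ℕ) (k : Fin n → YMSpecies G) (a : E) (F : SchwartzMap (Fin n → E) ℂ), IsOffDiagonal F → S n k (translateMulti a F) = S n k F) ∧ (∀ (n : ℕ) (k : Fin n → YMSpecies G) (R : E ≃ₗᵢ[ℝ] E), LinearMap.det (R.toLinearEquiv : E →ₗ[ℝ] E) = 1 → (∀ i : Fin 4, ∃ j : Fin 4, R (EuclideanSpace.single i 1) = EuclideanSpace.single j 1 ∨ R (EuclideanSpace.single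 i 1) = -EuclideanSpace.single j 1) → ∀ F : SchwartzMap (Fin n → E) ℂ, IsOffDiagonal F → S n k (linActMulti R F) = S n k F)) ∧ (∀ (n : ℕ), n ≠ 0 → ∀ (σ : Fin n → YMSpecies G) (f : Fin n → SchwartzMap (E) ℝ) (F : SchwartzMap (Fin n → E) ℂ), IsTensorOf F (fun i => ofRealTest (f i)) → IsOffDiagonal F → Filter.Tendsto (fun k : ℕ => ((latticeSchwinger r.ρ sch (fun s => s.F) k n σ f : ℝ) : ℂ)) Filter.atTop (nhds (S n σ F))) ∧ (∃ (F₁ G₁ : SchwartzMap (Fin 1 → E) ℂ) (H₁ : SchwartzMap (Fin (1 + 1) → E) ℂ), IsTimeOrdered F₁ ∧ IsTimeOrdered G₁ ∧ IsAppendTensorOf H₁ (osAdjoint F₁) G₁ ∧ S (1 + 1) (fun _ => r.curvature) H₁ ≠ S 1 (fun _ => r.curvature) (osAdjoint F₁) * S 1 (fun _ => r.curvature) G₁) ∧ (∃ (f g h : SchwartzMap (E) ℂ) (Ffgh : SchwartzMap (Fin 3 → E) ℂ) (Fgh Ffh Ffg : SchwartzMap (Fin 2 → E) ℂ) (Ff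 Fg Fh : SchwartzMap (Fin 1 → E) ℂ), IsTensorOf Ffgh ![f, g, h] ∧ IsOffDiagonal Ffgh ∧ IsTensorOf Fgh ![g, h] ∧ IsTensorOf Ffh ![f, h] ∧ IsTensorOf Ffg ![f, g] ∧ IsTensorOf Ff ![f] ∧ IsTensorOf Fg ![g] ∧ IsTensorOf Fh ![h] ∧ S 3 (fun _ => r.curvature) Ffgh - S 1 (fun _ => r.curvature) Ff * S 2 (fun _ => r.curvature) Fgh - S 1 (fun _ => r.curvature) Fg * S 2 (fun _ => r.curvature) Ffh - S 1 (fun _ => r.curvature) Fh * S 2 (fun _ => r.curvature) Ffg + 2 * (S 1 (fun _ => r.curvature) Ff * S 1 (fun _ => r.curvature) Fg * S 1 (fun _ => r.curvature) Fh) ≠ 0) ∧ (∃ Δ : ℝ, 0 < Δ ∧ S.HasMassGap Δ ∧ HasLatticeMassGap r sch Δ); let W₁ := fun (r : LatticeRep G) (sch : SpeciesScheme (YMSpecies G)) (S₁ : SchwingerFamily E) => ((∀ (n : ℕ), n ≠ 0 → ∀ (f : Fin n → SchwartzMap (E) ℝ) (F : SchwartzMap (Fin n → E) ℂ), IsTensorOf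 F (fun i => ofRealTest (f i)) → IsOffDiagonal F → Filter.Tendsto (fun k : ℕ => ((latticeSchwinger r.ρ sch (fun s => s.F) k n (fun _ => r.curvature) f : ℝ) : ℂ)) Filter.atTop (nhds (S₁ n F))) ∧ (S₁.toLabelled.IsNormalized ∧ S₁.toLabelled.IsHermitian ∧ S₁.toLabelled.HasLinearGrowth ∧ S₁.toLabelled.IsReflectionPositive ∧ S₁.toLabelled.IsSymmetric ∧ S₁.toLabelled.HasClusterProperty) ∧ (∀ (n : ℕ) (a : E) (F : SchwartzMap (Fin n → E) ℂ), IsOffDiagonal F → S₁ n (translateMulti a F) = S₁ n F) ∧ (∀ (R : E ≃ₗᵢ[ℝ] E), LinearMap.det (R.toLinearEquiv : E →ₗ[ℝ] E) = 1 → (∀ i : Fin 4, ∃ j : Fin 4, R (EuclideanSpace.single i 1) = EuclideanSpace.single j 1 ∨ R (EuclideanSpace.single i 1) = -EuclideanSpace.single j 1) → ∀ (n : ℕ) (F : SchwartzMap (Fin n → E) ℂ), IsOffDiagonal F → S₁ n (linActMulti R F) = S₁ n F) ∧ (∃ Δ : ℝ, 0 < Δ ∧ S₁.toLabelled.HasMassGap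 Δ ∧ HasLatticeMassGap r sch Δ)); ∀ (r : LatticeRep G) (sch : SpeciesScheme (YMSpecies G)) (S : LabelledSchwingerFamily (YMSpecies G) (E)), W r sch S → W₁ r sch (fun n => S n (fun _ => r.curvature)) ∧ (∀ (R : E ≃ₗᵢ[ℝ] E) (a b : ℝ), a ^ 2 + b ^ 2 = 1 → (a = 0 ∨ b = 0) → R (EuclideanSpace.single 0 1) = a • EuclideanSpace.single 0 1 + b • EuclideanSpace.single 1 1 → (SchwingerFamily.toLabelled (fun n => (S n (fun _ => r.curvature)).comp (linActMulti R))).IsReflectionPositive)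

/-- `CurvatureChannel` holds: proved by `Summit.QuantumFields.YangMills.Theorems.curvatureChannel_proof`. -/
theorem CurvatureChannel_holds : CurvatureChannel := _root_.Summit.QuantumFields.YangMills.Theorems.curvatureChannel_proof

/-- item stmt-QuantumFields-9667 · support · rank 9 · closed · proved by Summit.QuantumFields.YangMills.Theorems.mirrorTransport_proof (prover) · by planner
sources: OsterwalderSchrader1973, GlimmJaffe1987
[support] MODEL-BLIND BOOKKEEPING used inside CurvatureChannel (not in the assembly chain): if a
one-species family S on ℝ⁴ is invariant on ⁰𝒮 under a linear isometry g and its pull-back by the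
frame R₀ is reflection positive, then its pull-back by ANY frame R₁ with R₁ e₀ = g(R₀ e₀) is
reflection positive — linActMulti (R₀.trans g) = linActMulti g ∘ linActMulti R₀ on ⁰𝒮, and two
frames with the same time axis differ by an isometry fixing e₀, which preserves IsTimeOrdered and
commutes with the OS adjoint. [difficulty: provable-now] -/
@[route_item "route-QuantumFields-MirrorModularBoosts"]
def MirrorTransport : Prop :=
  open Literature.MathematicalPhysics.QuantumLattice Literature.MathematicalPhysics.AQFT Literature.MathematicalPhysics.QuantumFieldTheory in let E := EuclideanSpace ℝ (Fin 4); ∀ (S : SchwingerFamily E) (g R₀ R₁ : E ≃ₗᵢ[ℝ] E), (∀ (n : ℕ) (F : SchwartzMap (Fin n → E) ℂ), IsOffDiagonal F → S n (linActMulti g F) = S n F) → R₁ (EuclideanSpace.single 0 1) = g (R₀ (EuclideanSpace.single 0 1)) → (SchwingerFamily.toLabelled (fun n => (S n).comp (linActMulti R₀))).IsReflectionPositive → (SchwingerFamily.toLabelled (fun n => (S n).comp (linActMulti R₁))).IsReflectionPositive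

-- `MirrorTransport` holds: proved by `Summit.QuantumFields.YangMills.Theorems.mirrorTransport_proof` (its module imports this route file, so no `_holds` link can be stated here).

/-- item stmt-QuantumFields-9668 · support · rank 9 · closed · proved by Summit.QuantumFields.YangMills.Theorems.SpeciesProjectionPlanar_proof_mirrorModularBoosts @ a0ad46fc21ef (prover) · by planner
sources: JaffeWitten2000, Literature.MathematicalPhysics.QuantumFieldTheory.IsYangMillsFor, OsterwalderSeiler1978
[support] SPECIES BOOKKEEPING (the planar analogue of
CoincidenceRotationBootstrap.SpeciesProjection, provable now): if G admits (r, sch, S) with the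
HypercubicLimit clauses and planar-rotation-invariant curvature strings, then G admits (r, sch', S')
with the same clauses and planar-rotation invariance of EVERY species string — sch' = sch with c_s =
m_s = 0 for s ≠ r.curvature and S' n k := S n k if all k i = r.curvature, else 0 (lattice
correlators with a zero factor vanish; E2 of S' is E2 of S on the all-curvature sub-list;
HasLatticeMassGap does not see c, m). The Statement renormalises non-scalar species to 0
(YangMillsOS docstring; JaffeWitten2000 §4 fn. 1); HasLatticeMassGap keeps the all-observable teeth.
[difficulty: provable-now] -/
@[route_item "route-QuantumFields-MirrorModularBoosts"]
def SpeciesProjectionPlanar : Prop :=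
  open Literature.MathematicalPhysics.QuantumLattice Literature.MathematicalPhysics.AQFT Literature.MathematicalPhysics.QuantumFieldTheory in let E := EuclideanSpace ℝ (Fin 4); ∀ (G : Type) [Group G] [TopologicalSpace G] [IsTopologicalGroup G] [CompactSpace G], IsCompactSimpleLieGroup G → letI : MeasurableSpace G := borel G; haveI : BorelSpace G := ⟨rfl⟩; let W := fun (r : LatticeRep G) (sch : SpeciesScheme (YMSpecies G)) (S : LabelledSchwingerFamily (YMSpecies G) (E)) => (S.IsNormalized ∧ S.IsHermitian ∧ S.HasLinearGrowth ∧ S.IsReflectionPositive ∧ S.IsSymmetric ∧ S.HasClusterProperty ∧ (∀ (n : ℕ) (k : Fin n → YMSpecies G) (a : E) (F : SchwartzMap (Fin n → E) ℂ), IsOffDiagonal F → S n k (translateMulti a F) = S n k F) ∧ (∀ (n : ℕ) (k : Fin n → YMSpecies G) (R : E ≃ₗᵢ[ℝ] E), LinearMap.det (R.toLinearEquiv : E →ₗ[ℝ] E) = 1 → (∀ i : Fin 4, ∃ j : Fin 4, R (EuclideanSpace.single i 1) = EuclideanSpace.single j 1 ∨ R (EuclideanSpace.single i 1) = -EuclideanSpace.single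 j 1) → ∀ F : SchwartzMap (Fin n → E) ℂ, IsOffDiagonal F → S n k (linActMulti R F) = S n k F)) ∧ (∀ (n : ℕ), n ≠ 0 → ∀ (σ : Fin n → YMSpecies G) (f : Fin n → SchwartzMap (E) ℝ) (F : SchwartzMap (Fin n → E) ℂ), IsTensorOf F (fun i => ofRealTest (f i)) → IsOffDiagonal F → Filter.Tendsto (fun k : ℕ => ((latticeSchwinger r.ρ sch (fun s => s.F) k n σ f : ℝ) : ℂ)) Filter.atTop (nhds (S n σ F))) ∧ (∃ (F₁ G₁ : SchwartzMap (Fin 1 → E) ℂ) (H₁ : SchwartzMap (Fin (1 + 1) → E) ℂ), IsTimeOrdered F₁ ∧ IsTimeOrdered G₁ ∧ IsAppendTensorOf H₁ (osAdjoint F₁) G₁ ∧ S (1 + 1) (fun _ => r.curvature) H₁ ≠ S 1 (fun _ => r.curvature) (osAdjoint F₁) * S 1 (fun _ => r.curvature) G₁) ∧ (∃ (f g h : SchwartzMap (E) ℂ) (Ffgh : SchwartzMap (Fin 3 → E) ℂ) (Fgh Ffh Ffg : SchwartzMap (Fin 2 → E) ℂ) (Ff Fg Fh : SchwartzMap (Fin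 1 → E) ℂ), IsTensorOf Ffgh ![f, g, h] ∧ IsOffDiagonal Ffgh ∧ IsTensorOf Fgh ![g, h] ∧ IsTensorOf Ffh ![f, h] ∧ IsTensorOf Ffg ![f, g] ∧ IsTensorOf Ff ![f] ∧ IsTensorOf Fg ![g] ∧ IsTensorOf Fh ![h] ∧ S 3 (fun _ => r.curvature) Ffgh - S 1 (fun _ => r.curvature) Ff * S 2 (fun _ => r.curvature) Fgh - S 1 (fun _ => r.curvature) Fg * S 2 (fun _ => r.curvature) Ffh - S 1 (fun _ => r.curvature) Fh * S 2 (fun _ => r.curvature) Ffg + 2 * (S 1 (fun _ => r.curvature) Ff * S 1 (fun _ => r.curvature) Fg * S 1 (fun _ => r.curvature) Fh) ≠ 0) ∧ (∃ Δ : ℝ, 0 < Δ ∧ S.HasMassGap Δ ∧ HasLatticeMassGap r sch Δ); (∃ (r : LatticeRep G) (sch : SpeciesScheme (YMSpecies G)) (S : LabelledSchwingerFamily (YMSpecies G) (E)), W r sch S ∧ (∀ (R : E ≃ₗᵢ[ℝ] E), LinearMap.det (R.toLinearEquiv : E →ₗ[ℝ] E) = 1 → R (EuclideanSpace.single 2 1)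 = EuclideanSpace.single 2 1 → R (EuclideanSpace.single 3 1) = EuclideanSpace.single 3 1 → ∀ (n : ℕ) (F : SchwartzMap (Fin n → E) ℂ), IsOffDiagonal F → S n (fun _ => r.curvature) (linActMulti R F) = S n (fun _ => r.curvature) F)) → ∃ (r : LatticeRep G) (sch : SpeciesScheme (YMSpecies G)) (S : LabelledSchwingerFamily (YMSpecies G) (E)), W r sch S ∧ (∀ (R : E ≃ₗᵢ[ℝ] E), LinearMap.det (R.toLinearEquiv : E →ₗ[ℝ] E) = 1 → R (EuclideanSpace.single 2 1) = EuclideanSpace.single 2 1 → R (EuclideanSpace.single 3 1) = EuclideanSpace.single 3 1 → ∀ (n : ℕ) (k : Fin n → YMSpecies G) (F : SchwartzMap (Fin n → E) ℂ), IsOffDiagonal F → S n k (linActMulti R F) = S n k F)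

-- `SpeciesProjectionPlanar` holds: proved by `Summit.QuantumFields.YangMills.Theorems.SpeciesProjectionPlanar_proof_mirrorModularBoosts` @ a0ad46fc21ef (its module imports this route file, so no `_holds` link can be stated here).

/-- item stmt-QuantumFields-9669 · support · rank 9 · closed · proved by Summit.QuantumFields.YangMills.Theorems.PlanarToEuclidean_proof @ 26cdd46311db (prover) · by planner
sources: OsterwalderSchrader1973, Haag1996
[support] EXACT GROUP THEORY, any label type (provable now): invariance on ⁰𝒮 under the proper
signed permutations and under every determinant-one isometry fixing e₂, e₃ implies invariance under
every determinant-one linear isometry of ℝ⁴ — the invariance set is a subgroup of E ≃ₗᵢ E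
(IsOffDiagonal is preserved); conjugating SO(2)₀₁ by proper signed permutations (e.g. (e₁ e₂)(e₃ ↦
−e₃)) gives SO(2)_μν for all six coordinate planes; Givens rotations generate SO(4) exactly, no
closure or density needed. [difficulty: provable-now] -/
@[route_item "route-QuantumFields-MirrorModularBoosts"]
def PlanarToEuclidean : Prop :=
  open Literature.MathematicalPhysics.QuantumLattice Literature.MathematicalPhysics.AQFT Literature.MathematicalPhysics.QuantumFieldTheory in let E := EuclideanSpace ℝ (Fin 4); ∀ (ι : Type) (S : LabelledSchwingerFamily ι (E)), (∀ (n : ℕ) (k : Fin n → ι) (R : E ≃ₗᵢ[ℝ] E), LinearMap.det (R.toLinearEquiv : E →ₗ[ℝ] E) = 1 → (∀ i : Fin 4, ∃ j : Fin 4, R (EuclideanSpace.single i 1) = EuclideanSpace.single j 1 ∨ R (EuclideanSpace.single i 1) = -EuclideanSpace.single j 1) → ∀ F : SchwartzMap (Fin n → E) ℂ, IsOffDiagonal F → S n k (linActMulti R F) = S n k F) → (∀ (R : E ≃ₗᵢ[ℝ] E), LinearMap.det (R.toLinearEquiv : E →ₗ[ℝ] E) = 1 → R (EuclideanSpace.single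 2 1) = EuclideanSpace.single 2 1 → R (EuclideanSpace.single 3 1) = EuclideanSpace.single 3 1 → ∀ (n : ℕ) (k : Fin n → ι) (F : SchwartzMap (Fin n → E) ℂ), IsOffDiagonal F → S n k (linActMulti R F) = S n k F) → ∀ (n : ℕ) (k : Fin n → ι) (R : E ≃ₗᵢ[ℝ] E), LinearMap.det (R.toLinearEquiv : E →ₗ[ℝ] E) = 1 → ∀ F : SchwartzMap (Fin n → E) ℂ, IsOffDiagonal F → S n k (linActMulti R F) = S n k F

/-- `PlanarToEuclidean` holds: proved by `Summit.QuantumFields.YangMills.Theorems.PlanarToEuclidean_proof` @ 26cdd46311db. -/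
theorem PlanarToEuclidean_holds : PlanarToEuclidean := _root_.Summit.QuantumFields.YangMills.Theorems.PlanarToEuclidean_proof

-- earlier Assembly (stmt-QuantumFields-10707, replaced 2026-08-17T17:27:06Z -> stmt-QuantumFields-18786): proved by Summit.QuantumFields.YangMills.Theorems.mirrorModularBoosts_assembly_proof @ 25e9d7d66ad9 — CurvatureBoostCovariance → PlanarSpectralCone → DiagonalMirrorRPR → HypercubicLimit → CurvatureChannel → SpeciesProjectionPlanar → PlanarToEuclidean → YangMills
-- earlier Assembly (stmt-QuantumFields-18786, replaced 2026-08-31T13:47:14Z -> stmt-QuantumFields-27393): proved by Summit.QuantumFields.YangMills.Theorems.mirrorModularBoosts_assembly_proof — CurvatureKernelBound → SoftKernelBoostCovariance → PlanarSpectralCone → DiagonalMirrorRPR → WeakCouplingHypercubicLimit → YangMills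
-- earlier Assembly (stmt-QuantumFields-9670, replaced 2026-08-15T16:21:31Z -> stmt-QuantumFields-10707): retired by None — CurvatureBoostCovariance → PlanarSpectralCone → DiagonalMirrorRP → HypercubicLimit → CurvatureChannel → SpeciesProjectionPlanar → PlanarToEuclidean → YangMills
/-- item stmt-QuantumFields-27393 · assembly · rank 1 · open · by operator
sources: OsterwalderSchrader1975, JaffeWitten2000
[assembly] the deciding chain BY NAME after the FOLD (shape F), verbatim the curried type of the new
`closes`: CurvatureKernelBound → SoftKernelBoostCovariance → PlanarSpectralCone →
WeakCouplingHypercubicLimitRP → YangMills. Restated by name so that the landed `unfold Assembly;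
exact closes` proof elaborates again (IFPC: after a 1-line `intro` adapter). [difficulty:
provable-now] -/
@[route_item "route-QuantumFields-MirrorModularBoosts"]
def Assembly : Prop :=
  CurvatureKernelBound → SoftKernelBoostCovariance → PlanarSpectralCone → WeakCouplingHypercubicLimitRP → YangMills

-- records of items no longer active in this route (dropped / restated):
-- earlier DiagonalMirrorRP (stmt-QuantumFields-9665, dropped 2026-08-15T16:48:56Z): refuted by Summit.QuantumFields.YangMills.Theorems.MirrorModularBoostsDiagonalMirrorRP_refuted @ 5008a3f789a5 — open Literature.MathematicalPhysics.QuantumLattice Literature.MathematicalPhysics.AQFT Literature.MathematicalPhysics.QuantumFieldTheory in let E := EuclideanSpace ℝ (Fin 4); ∀ (G : Type) [Group G] [Topolog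

/-! D-0027 §2.1 — DECIDING THEOREM (planner-authored via `route open/edit --closes-file`; by operator:999:4094315 2026-08-31T13:47:14Z):
its hypotheses are this route's items and its conclusion the sub-problem Statement (glue_lint), and it elaborates with this file. -/

-- glue.lean — deciding theorem of route MirrorModularBoosts after the FOLD (shape F; director-ym O4 WORD 1 (3), riders r1–r3, O4 NOTE 1; kit tenure-10604-restate-1-g1,
-- 2026-08-31). VERBATIM today's certified `closes` (rev 18) except: the binder `(hDiag : DiagonalMirrorRPR)` is GONE and the existence-leg binder is the new crux
-- `WeakCouplingHypercubicLimitRP` (= WeakCouplingHypercubicLimit ∧ diagonal-frame RP of the curvature channel of the SAME witness); the third case of the eight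
-- mirror lines reads that conjunct (`hRP`) instead of the universal crux. HONEST LABEL: a re-typing — the diagonal-RP content moved from a universal crux (strategist r1:
-- over-universal) into the existence leg at its witness, which was and remains OPEN and summit-strength; nothing is proved; the Yang–Mills mass gap is NOT proved.
@[closes "route-QuantumFields-MirrorModularBoosts"] theorem closes (hKB : CurvatureKernelBound) (hSoft : SoftKernelBoostCovariance)
    (hCone : PlanarSpectralCone) (hWHL : WeakCouplingHypercubicLimitRP) : YangMills := by
  -- crux-only deciding theorem (human ruling 2026-08-16), re-elaborated after the Statement re-type
  -- p116790 (`YangMills` gained the conjunct `sch.HasWeakCouplingLimit`): the existence leg is now the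
  -- WEAK-COUPLING hypercubic limit (HypercubicLimit ∧ β_k → ∞ for the SAME scheme), and the weak-coupling
  -- clause rides unchanged through the species bookkeeping (`onlySpecies` keeps `β`). The proved support
  -- items are USED through their landed proofs, never assumed — CurvatureChannel
  -- (Theorems.PencilRigidityCurvatureChannel), PlanarToEuclidean (Theorems.PencilRigidityPlanarToEuclidean);
  -- SpeciesProjectionPlanar is re-derived below from the tree's one-field reduction
  -- (Theorems.HypercubicLimit.Negative.OneFieldReduction); the pure-logic glue KernelBoundEngineGlue is inlined.
  have hCC : CurvatureChannel := _root_.Summit.QuantumFields.YangMills.Theorems.curvatureChannel_proof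
  have hPE : PlanarToEuclidean := _root_.Summit.QuantumFields.YangMills.Theorems.PlanarToEuclidean_proof
  -- the bundled engine (B) CurvatureBoostCovariance is the typed scalarity hypothesis on tr F²
  -- (K) CurvatureKernelBound fed to the engine below dimension five (B′) SoftKernelBoostCovariance
  have hEng : CurvatureBoostCovariance := by
    intro G _ _ _ _ hG
    letI : MeasurableSpace G := borel G
    haveI : BorelSpace G := ⟨rfl⟩
    intro W₁ r sch S₁ hW₁ h8 hcone
    exact hSoft G hG r sch S₁ hW₁ h8 hcone (hKB G hG r sch S₁ hW₁)
  intro G i1 i2 i3 i4 hG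
  letI : MeasurableSpace G := borel G
  haveI : BorelSpace G := ⟨rfl⟩
  -- the weak-coupling existence leg: scheme `sch` with `β_k → ∞`, the diagonal-frame RP of its curvature
  -- channel `hRP` (FOLD, shape F) and the HypercubicLimit clauses `hW`
  obtain ⟨r, sch, S, hweak, hRP, hW⟩ := hWHL G hG
  obtain ⟨hW₁, hAxis⟩ := hCC G hG r sch S hW
  obtain ⟨hconv₁, hpkg₁, htr₁, hhyp₁, Δ₁, hΔ₁, hgap₁, hlat₁⟩ := hW₁
  -- the eight oriented mirror lines of the (x₀,x₁)-plane: axis frames from CurvatureChannel,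
  -- diagonal frames read off the existence leg AT ITS OWN WITNESS (conjunct `hRP` of
  -- WeakCouplingHypercubicLimitRP; FOLD 2026-08-31 — formerly the universal crux DiagonalMirrorRPR)
  have h8 : ∀ (R : EuclideanSpace ℝ (Fin 4) ≃ₗᵢ[ℝ] EuclideanSpace ℝ (Fin 4)) (a b : ℝ), a ^ 2 + b ^ 2 = 1 →
      (a = 0 ∨ b = 0 ∨ a ^ 2 = b ^ 2) →
      R (EuclideanSpace.single 0 1) = a • EuclideanSpace.single 0 1 + b • EuclideanSpace.single 1 1 →
      (Literature.MathematicalPhysics.QuantumLattice.SchwingerFamily.toLabelled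
        (fun n => (S n (fun _ => r.curvature)).comp
          (Literature.MathematicalPhysics.QuantumLattice.linActMulti R))).IsReflectionPositive := by
    intro R a b hab hcase hR
    rcases hcase with h0 | h0 | h0
    · exact hAxis R a b hab (Or.inl h0) hR
    · exact hAxis R a b hab (Or.inr h0) hR
    · have ha : a ^ 2 = 1 / 2 := by linarith
      have hb : b ^ 2 = 1 / 2 := by linarith
      exact hRP R a b ha hb hR
  obtain ⟨hnorm₁, hherm₁, hgrowth₁, hrp₁, hsymm₁, hclus₁⟩ := hpkg₁
  -- planar spectral cone, then the engine: planar rotations of the curvature channel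
  have hcone := hCone (fun n => S n (fun _ => r.curvature)) hgrowth₁ hsymm₁ htr₁ h8
  have hplanar := hEng G hG r sch (fun n => S n (fun _ => r.curvature))
    ⟨hconv₁, ⟨hnorm₁, hherm₁, hgrowth₁, hrp₁, hsymm₁, hclus₁⟩, htr₁, hhyp₁, Δ₁, hΔ₁, hgap₁, hlat₁⟩ h8 hcone
  -- species bookkeeping (formerly the proved support SpeciesProjectionPlanar, inlined): every
  -- species other than the curvature renormalised to zero (`onlySpecies sch r.curvature`, same `β`),
  -- the family extended by zero
  obtain ⟨⟨hnorm, hherm, hgrowth, hrp, hsymm, hclus, htr, hhyp⟩, hconv, hnt, hng, Δ, hΔ, hgap, hlat⟩ :=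
    _root_.Summit.QuantumFields.YangMills.Theorems.HypercubicLimit.Negative.clauses_of_clauses₁
      (_root_.Summit.QuantumFields.YangMills.Theorems.HypercubicLimit.Negative.clauses₁_of_clauses hW)
  have hrot' : ∀ (R : EuclideanSpace ℝ (Fin 4) ≃ₗᵢ[ℝ] EuclideanSpace ℝ (Fin 4)),
      LinearMap.det (R.toLinearEquiv : EuclideanSpace ℝ (Fin 4) →ₗ[ℝ] EuclideanSpace ℝ (Fin 4)) = 1 →
      R (EuclideanSpace.single 2 1) = EuclideanSpace.single 2 1 →
      R (EuclideanSpace.single 3 1) = EuclideanSpace.single 3 1 →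
      ∀ (n : ℕ) (k : Fin n → Literature.MathematicalPhysics.QuantumFieldTheory.YMSpecies G)
        (F : SchwartzMap (Fin n → EuclideanSpace ℝ (Fin 4)) ℂ),
        Literature.MathematicalPhysics.AQFT.IsOffDiagonal F →
        _root_.Summit.QuantumFields.YangMills.Theorems.HypercubicLimit.Negative.extendByZero r.curvature
            (_root_.Summit.QuantumFields.YangMills.Theorems.HypercubicLimit.Negative.restrictTo r.curvature S)
            n k (Literature.MathematicalPhysics.QuantumLattice.linActMulti R F) =
          _root_.Summit.QuantumFields.YangMills.Theorems.HypercubicLimit.Negative.extendByZero r.curvature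
            (_root_.Summit.QuantumFields.YangMills.Theorems.HypercubicLimit.Negative.restrictTo r.curvature S)
            n k F := by
    intro R hdet h2 h3 n k F hF
    by_cases hk : ∀ i, k i = r.curvature
    · rw [_root_.Summit.QuantumFields.YangMills.Theorems.HypercubicLimit.Negative.extendByZero_of_all
        r.curvature _ hk]
      exact hplanar R hdet h2 h3 n F hF
    · rw [_root_.Summit.QuantumFields.YangMills.Theorems.HypercubicLimit.Negative.extendByZero_of_not_all
        r.curvature _ hk]
      rfl
  have hE1 : (_root_.Summit.QuantumFields.YangMills.Theorems.HypercubicLimit.Negative.extendByZero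
      r.curvature
      (_root_.Summit.QuantumFields.YangMills.Theorems.HypercubicLimit.Negative.restrictTo
        r.curvature S)).IsEuclideanInvariant :=
    ⟨htr, fun n k R hdet F hF =>
      hPE (Literature.MathematicalPhysics.QuantumFieldTheory.YMSpecies G) _ hhyp hrot' n k R hdet F hF⟩
  -- the weak-coupling clause of the species-projected scheme: `onlySpecies` only zeroes `c`, so its
  -- inverse bare coupling IS `sch.β` and the clause is `hweak` verbatim
  have hweak' : (_root_.Summit.QuantumFields.YangMills.Theorems.HypercubicLimit.Negative.onlySpecies
      sch r.curvature).HasWeakCouplingLimit := hweak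
  -- the Osterwalder–Schrader data and the clauses of `YangMills` (weak coupling first)
  exact ⟨r, _, ⟨_, hnorm, hherm, hgrowth, hE1, hrp, hsymm, hclus⟩, hweak', hconv, hnt, hng, Δ, hΔ, hgap, hlat⟩

end Summit.QuantumFields.YangMills.Theses.MirrorModularBoosts
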